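import Literature.MathematicalPhysics.QuantumFieldTheory.Balaban1983to89.B6QGQCoerciveMultiLevelBoxL0
import Literature.MathematicalPhysics.QuantumFieldTheory.Balaban1983to89.B6Prop22MultiLevelTorusL0
import Literature.MathematicalPhysics.QuantumFieldTheory.Balaban1983to89.B6Geom246MultiLevelBoxL0
import Literature.MathematicalPhysics.QuantumFieldTheory.Balaban1983to89.B6Ineq268MultiLevelBoxL0
import Literature.MathematicalPhysics.QuantumFieldTheory.Balaban1983to89.B6MultiLevelBoxOperatorL0
import Literature.MathematicalPhysics.QuantumFieldTheory.Balaban1983to89.B6MultiLevelTorusOperatorL0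
import Literature.MathematicalPhysics.QuantumFieldTheory.Balaban1983to89.B6QGGQCoerciveMultiLevelTorus
/-!
# `Balaban1983to89.B6QGGQCoerciveMultiLevelTorusL0` — LEVEL-0 TWIN (programme G-F3′-L0, director-ym LINE №27 / UV3-NODE §24.5; plan `lit-balaban-r03/G-F3L0-PLAN.md`) of `B6QGGQCoerciveMultiLevelTorus`:
the same declarations, SAME NAMES AND STATEMENTS, for nested families WITH print's region `Λ₀ = T ∖ Ω₁` ADMITTED (structures
`B6MultiLevelBoxOperatorL0.Domains` / `B6MultiLevelTorusOperatorL0.TDomains`: levels `0, …, k`, the level-`0` block a single site, `Q′₀ = id`,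
finite weight `a₀` — print p.225 (2.14) «Σ_{j=0}^k … (Q′₀λ)(x) = λ(x), x ∈ Λ₀», p.229 «taking a sequence (2.1) … smallest possible domains B^j(Λ_j),
and considering the operator Δ_a defined by (2.19), (2.20) for this sequence»).  Every `D`-free object is the lineage's, consumed BY NAME; no existing
module is touched; no fact is minted.  Unit `lit-balaban-r03` (B6 fold owner, r03 gen 36); referee ref-4.  THE TWIN'S DOCUMENTATION FOLLOWS
VERBATIM (its «levels 1 … k» / «Ω₁ = X» sentences describe the twin; here `j` runs from `0` and `Ω₁` may be a proper subset).

# `Balaban1983to89.B6QGGQCoerciveMultiLevelTorus` — [B6] (2.78) FOR THE GENUINE `k`-LEVEL OPERATOR ON THE TORUS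
`T_η`, LEVEL-WEIGHTED AND GLOBAL: `⟨ω, Q′G′²Q′*ω⟩ = ‖G′Q′*ω‖² ≥ γ·Σ_y (L^jη)^{d}(L^jη)⁴ω(y)²` for `G′ = Δ′_a⁻¹` of an
ARBITRARY nested family (2.1)–(2.2) on print's carrier `T_η` and for EVERY `ω` on `𝔅` (not only for `ω` carried by a
two-level window), uniformly in `k` and in the family (file 2 of the torus `(Q′G′²Q′*)⁻¹` programme of seat p21; no
existing module is touched; no fact is minted)

FRAMING (verbatim cell line):
statement-level skeleton of published theorems with citation tags; proofs where landed; nothing here is a claim about the Yang–Mills mass gap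

Source under audit (cell pub-balaban / lit-balaban): T. Bałaban, *Propagators and renormalization transformations for
lattice gauge theories. II*, Commun. Math. Phys. **96** (1984) 223–250 [`Balaban1984PropagatorsII`, "B6"], pp. 235–237
[PDF 13–15] (2.70)–(2.79) (held text `paper:balaban1984-cmp96-propagators-rt-ii` p0013–p0015, re-read this generation);
T. Bałaban, *… I*, Commun. Math. Phys. **95** (1984) 17–40 [`Balaban1984PropagatorsI`, "[4]"], p. 25 (the positivity
of `Q′G′Q′*`).  Unit `lit-balaban-p21` (Phase-2 proof seat p21 gen 16), HOME `run/shared/lean/pub/lit-balaban/`,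
free-target protocol G.5-34(d) (B6-CLOSURE item 7 (d2) of the fold owner r03), referee ref-4.

## WHAT IS PRINTED (pp. 236–237, verbatim up to notation)

«We have ⟨ω, (Q′G′^ξ(□̃)²Q′*)↾□ ω⟩ = ‖G′^ξ(□̃)Q′*ω₁‖² (2.72) … By Bessel's inequality the squared norm can be estimated from
below … (2.73) … Next we consider the quadratic form ⟨ω₁, Q′_jG′_j(□̃)Q′_j*ω₁⟩ … ≥ … (2.74) … From this representation and
the bounds (2.50), (2.51) of that paper it follows that Q′_jG′_jQ′_j* ≥ 2γ₀, (2.76) γ₀ is a positive, absolute constant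
(a = 1). For M sufficiently large we obtain ⟨ω₁, Q′_jG′_j(□̃)Q′_j*ω₁⟩ ≥ γ₀‖ω₁‖². (2.77) The inequalities (2.73) and
(2.77) together with the equalities (2.71) and (2.72) imply ⟨ω, (Q′G′^ξ(□̃)²Q′*)ω⟩ ≥ γ₀²‖ω₁‖² = γ₀²‖Q″*ω‖² ≥ γ₀²‖ω‖².
(2.78)»  p. 237: «Of course we have also a bound from above and an exponential decay of the kernel of Q′G′^ξ(□̃)²Q′* with
the decay rate δ₀. Hence the operator C^ξ_□ is bounded from above and below by absolute constants. We can use the theory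
developed in Sect. 5 [3] to conclude that it has an exponential decay with a decay rate δ₁ depending on δ₀ and the bound
γ₀.»

## WHAT THIS FILE CERTIFIES (kernel-checked; setting of `B6MultiLevelTorusOperator` / `B6QGQCoerciveMultiLevelBox`)

For every nested family `D : TDomains d ℓ M_h k P R` on the TORUS `T_η` (levels `1 … k`, `Ω₁ = T_η`, fundamental box
`Π_μ[0, L^k·L·M_h·P_μ)`, lattice units, spatial dimension `d + 1`, `L = ℓ + 1 ≥ 2`, `M_h, P_μ ≥ 1`), every weight sequence
`0 < a_j ≤ a₊` (`j ≥ 1`), the genuine `k`-level `Δ′_a = mlOpT` on the torus and `G′ = gmlT = Δ′_a⁻¹`: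
* §1 the SECOND-ORDER-FLAT discrete profile `β̃(r) = n·((r+1)(n−r))²/S_n` on `{0,…,n−1}` (`bump4N`): exact normalisation
  `Σ_{r<n}β̃(r) = n` (closed form `S_n = (n+1)((n+1)⁴−1)/30`), `0 ≤ β̃ ≤ 4`, END VALUES `β̃(0), β̃(n−1) ≤ 60/n²`, END
  DIFFERENCES `|β̃(1)−β̃(0)|, |β̃(n−1)−β̃(n−2)| ≤ 180/n²`, SECOND DIFFERENCES `|β̃(r+1)−2β̃(r)+β̃(r−1)| ≤ 180/n²`;
* §2 the block bump `b(x) = Π_μ β̃_{L^j}(x_μ mod L^j)` on a box family (`bump4`): block sums `W(y)` (`sum_bump4_fiber`), `≤ 4^{d+1}`,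
  `≤ (60/n²)4^d` on the faces of the block (`bump4_face_le`), the step identities inside the block (`bump4_add_single`);
* §3 the test field `v = Σ_y (L^j)⁴ω(y)·b·1_{B^j(y)}` (`testV4`) with `⟨v, Q′*ω⟩ = T(ω) := Σ_y W(y)(L^j)⁴ω(y)²` (`testV4_dot_QsB`),
  the local error scale `E(x) = (L^j)²|ω(y)|` with `Σ_xE(x)² = T(ω)` (`sum_Esc_sq`), and the three `O((L^j)²|ω|)` bounds:
  face values, interior second differences, one-sided differences at the faces (`abs_testV4_le_of_face`,
  `abs_testV4_secondDiff_le`, `abs_testV4_sub_le_of_top/bot`);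
* §4 TORUS NEIGHBOURS VS BLOCKS: a torus bond `x → σ_{±e_μ}x` stays in the block of `x` unless `x` lies on the
  corresponding face (`fwd_of_lt`, `bwd_of_pos`, `top_of_blkOf_fwd_ne`, `bot_of_blkOf_bwd_ne`), and from a face it does
  leave (`blkOf_fwd_ne_of_top`, `blkOf_bwd_ne_of_bot`: a block never wraps around `T_η`, `L^j < N₀`); hence the bond-pair
  bound `|2v(x) − v(σ_{e_μ}x) − v(σ_{−e_μ}x)| ≤ 240·4^dE(x) + 60·4^d(E(σ_{e_μ}x) + E(σ_{−e_μ}x))` (`abs_pair_le`);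
* §5 the row formula `(Δ′_av)(x) = (−Δ^{per}v)(x) + levC_{j}Σ_{B(y)}v` (`mlOpT_mulVec_apply`), the pointwise bound
  `|(Δ′_av)(x)| ≤ c₁E(x) + c₂Σ_μ(E(σ_{e_μ}x) + E(σ_{−e_μ}x))` (`abs_mlOpT_testV4_le`; the averaging row is `a_j(L^j)²ω(y)`
  exactly), **`‖Δ′_av‖² ≤ C₄·T(ω)`** (`normSq_mlOpT_testV4_le`, `C₄ = 2c₁² + 8(d+1)²c₂²`, translation invariance of the
  counting measure `Σ_xE(σx)² = T(ω)`), and **(2.78) LEVEL-WEIGHTED AND GLOBAL** (`qggq_coercive_multiLevelTorus`):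
  `‖G′Q′*ω‖² ≥ C₄⁻¹·Σ_y W(y)(L^j)⁴ω(y)²` FOR EVERY `ω` ON `𝔅`, by `T(ω) = ⟨Q′*ω, v⟩ = ⟨G′Q′*ω, Δ′_av⟩ ≤ ‖G′Q′*ω‖·‖Δ′_av‖`
  (`Δ′_aG′ = 1`, symmetry of `Δ′_a`, Cauchy–Schwarz).  All constants depend on `d` and `a₊` only: uniform in `k`, `M_h`,
  `R`, `P`, `L` and the family — the input «bounded from below by absolute constants» of p. 237 for «the theory developed
  in Sect. 5 [3]», here available on the WHOLE block lattice `𝔅` of the torus (next file).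

## HONEST SCOPE

* Print proves (2.78) per cube `□` on two adjacent levels via (2.73)–(2.77) (Bessel + the one-level Fourier representation
  (2.75) of [4]); the Neumann-box twin `B6QGQCoerciveMultiLevelBoxL0.qggq_coercive_window` proves it by the variational
  principle with a first-order block bump, again on two-level windows.  THIS FILE proves the level-weighted lower bound
  for ALL `ω` at once (our strengthening; a genuinely shorter road to the p. 237 input of [3] Sect. 5): the test field
  carries the weight `(L^jη)⁴` and a bump flat to SECOND order at the block faces, so that `Δ′_av` is `O((L^jη)²|ω(y)|)`
  sitewise across blocks of different levels; no Fourier analysis, no restriction to one or two levels.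
* Print's carrier `T_η` with `Ω₁ = T_η` (levels `1 … k`), `A = 0`, `m² = 0`, lattice units (the weights `(L^jη)²`,
  `(L^jη)⁴` are print's rescaling to the `ξ = L^{−j}` lattice ((2.71), (2.80)) written in `η`-units); `L ≥ 2`; constants
  explicit (`C₄ = 2(240(d+1)4^d + a₊)² + 8(d+1)²(60·4^d)²`), not optimised.  (2.74)–(2.77) for `Q′G′Q′*` itself are not
  re-derived on the torus here (the box file has them; they are not inputs of Prop. 2.3).
* Nothing is inferred from the manuscript: every step is kernel-checked; the quoted sentences locate the statements.
-/

namespace Literature.MathematicalPhysics.QuantumFieldTheory.Balaban1983to89.B6QGGQCoerciveMultiLevelTorusL0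

open Finset Matrix
open Literature.MathematicalPhysics.QuantumFieldTheory.Balaban1983to89.B4Reflection242 (boxDom mem_boxDom blk)
open Literature.MathematicalPhysics.QuantumFieldTheory.Balaban1983to89.B6MultiLevelBoxOperator hiding Domains mlOp_apply
open Literature.MathematicalPhysics.QuantumFieldTheory.Balaban1983to89.B6MultiLevelBoxOperatorL0
open Literature.MathematicalPhysics.QuantumFieldTheory.Balaban1983to89.B6MultiLevelTorusOperator (mlOpT gmlT perLapT perLapT_mulVec tshift tshift_val tshift_val_of_mem tshift_tshift tshift_zero unitVec mlOpT_isSymm N0_eq_bigSide_mul)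
open Literature.MathematicalPhysics.QuantumFieldTheory.Balaban1983to89.B6MultiLevelTorusOperatorL0 (TDomains mlOpT_apply)
open Literature.MathematicalPhysics.QuantumFieldTheory.Balaban1983to89.B6Geom246MultiLevelBox hiding Touch blkOf blkOf_corner blkOf_eq_iff_blk blkOf_eq_of_blk_i_eq blkOf_val bond bond_adj bset cen connected coord_bounds corner corner_mem csys dist_blkOf_le_box dist_blkOf_le_coord dist_blkOf_le_line dist_cen_le_of_adj dist_cen_le_of_touch dist_le_one_of_near dist_toR_cen_le exists_blkOf_eq geom lemma21_box lev_corner lev_eq_of_blkOf_eq levelGap pack reachable_blkOf reachable_of_near realizes scale_bounds touch_symm triangle_refl_nonneg walk_disp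
open Literature.MathematicalPhysics.QuantumFieldTheory.Balaban1983to89.B6Geom246MultiLevelBoxL0
open Literature.MathematicalPhysics.QuantumFieldTheory.Balaban1983to89.B6Ineq268MultiLevelBoxL0 (W W_pos W_eq QsB QsB_apply)
open Literature.MathematicalPhysics.QuantumFieldTheory.Balaban1983to89.B6QGQCoerciveMultiLevelBox (offN)
open Literature.MathematicalPhysics.QuantumFieldTheory.Balaban1983to89.B6QGQCoerciveMultiLevelBoxL0 (nb one_le_nb nb_cast W_eq_nb_pow block_fits siteOf blkOf_siteOf sum_fiber_eq_sum_chart sum_blockFun QsB_dot_QsB blk_eq_iff_blkOf_eq)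
open Literature.MathematicalPhysics.QuantumFieldTheory.Balaban1983to89.B6Prop22MultiLevelTorus (mlOpT_congr_weights)
open Literature.MathematicalPhysics.QuantumFieldTheory.Balaban1983to89.B6QGGQCoerciveMultiLevelTorus (bump4S bump4S_pos fwd_bwd bwd_fwd c1T c2T C4 C4_pos)

noncomputable section

variable {d : ℕ}

/-! ## §1 The second-order-flat profile `β̃(r) = n·((r+1)(n−r))²/S_n` on `{0, …, n−1}` -/

section Profile

/-- the quartic profile `β(r) = ((r+1)(n−r))²` (vanishing to SECOND order past both ends of `{0,…,n−1}`).
[cite: Balaban1984PropagatorsII, (2.74)–(2.78) p.236; Balaban1984PropagatorsI, p.25 (positivity of Q′G′Q′*); bookkeeping] -/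
def bump4β (n r : ℕ) : ℝ := (((r : ℝ) + 1) * ((n : ℝ) - r)) ^ 2

/-- the partial sums `Σ_{r<m} β(r)` in closed form. [folklore] -/
private def bump4P (n m : ℕ) : ℝ :=
  ((n : ℝ) + 1) ^ 2 * ((m : ℝ) * ((m : ℝ) + 1) * (2 * (m : ℝ) + 1) / 6)
    - ((n : ℝ) + 1) * ((m : ℝ) ^ 2 * ((m : ℝ) + 1) ^ 2 / 2)
    + (m : ℝ) * ((m : ℝ) + 1) * (2 * (m : ℝ) + 1) * (3 * (m : ℝ) ^ 2 + 3 * (m : ℝ) - 1) / 30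

/-- `Σ_{r<m} β(r) = bump4P n m`. [folklore] -/
private theorem sum_bump4β (n m : ℕ) : ∑ r ∈ Finset.range m, bump4β n r = bump4P n m := by
  induction m with
  | zero => simp [bump4P]
  | succ m ih =>
    rw [Finset.sum_range_succ, ih]
    unfold bump4P bump4β
    push_cast
    ring

/-- `Σ_{r<n} β(r) = S_n`. [cite: Balaban1984PropagatorsI, p.25 (positivity of Q′G′Q′*); bookkeeping] -/
theorem sum_bump4β_self (n : ℕ) : ∑ r ∈ Finset.range n, bump4β n r = bump4S n := by
  rw [sum_bump4β]; unfold bump4P bump4S; ring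

/-- **the normalised profile `β̃(r) = n·β(r)/S_n`**, so that `Σ_{r<n} β̃(r) = n`. [cite: Balaban1984PropagatorsI, p.25; bookkeeping] -/
def bump4N (n r : ℕ) : ℝ := (n : ℝ) * bump4β n r / bump4S n

/-- **`Σ_{r<n} β̃(r) = n`** (exact normalisation: block means of the bump are `1`). [cite: Balaban1984PropagatorsI, p.25; bookkeeping] -/
theorem sum_bump4N {n : ℕ} (hn : 1 ≤ n) : ∑ r ∈ Finset.range n, bump4N n r = n := by
  unfold bump4N
  rw [← Finset.sum_div, ← Finset.mul_sum, sum_bump4β_self]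
  exact (div_eq_iff (bump4S_pos hn).ne').mpr rfl

/-- `β̃ ≥ 0`. [cite: Balaban1984PropagatorsI, p.25 (positivity of Q′G′Q′*); bookkeeping] -/
theorem bump4N_nonneg (n r : ℕ) (hn : 1 ≤ n) : 0 ≤ bump4N n r := by
  unfold bump4N bump4β
  exact div_nonneg (mul_nonneg (Nat.cast_nonneg _) (sq_nonneg _)) (bump4S_pos hn).le

/-- `β(r) ≤ (n+1)⁴/16` for `r < n` (AM–GM on `(r+1) + (n−r) = n+1`). [cite: Balaban1984PropagatorsI, p.25 (positivity of Q′G′Q′*); bookkeeping] -/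
theorem bump4β_le {n r : ℕ} (hr : r < n) : bump4β n r ≤ ((n : ℝ) + 1) ^ 4 / 16 := by
  unfold bump4β
  have hrn : (r : ℝ) + 1 ≤ n := by exact_mod_cast hr
  have hp0 : 0 ≤ ((r : ℝ) + 1) * ((n : ℝ) - r) := mul_nonneg (by positivity) (by linarith)
  have h : ((r : ℝ) + 1) * ((n : ℝ) - r) ≤ ((n : ℝ) + 1) ^ 2 / 4 := by
    nlinarith [sq_nonneg ((n : ℝ) - 2 * r - 1)]
  calc _ ≤ (((n : ℝ) + 1) ^ 2 / 4) ^ 2 := pow_le_pow_left₀ hp0 h 2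
    _ = ((n : ℝ) + 1) ^ 4 / 16 := by ring

/-- **`β̃(r) ≤ 4`** (`r < n`). [cite: Balaban1984PropagatorsI, p.25; bookkeeping] -/
theorem bump4N_le {n r : ℕ} (hr : r < n) : bump4N n r ≤ 4 := by
  have hn : 1 ≤ n := by omega
  unfold bump4N
  have hS := bump4S_pos hn
  rw [div_le_iff₀ hS]
  have h1 : (1 : ℝ) ≤ n := by exact_mod_cast hn
  have hb := bump4β_le hr
  have hn0 : (0 : ℝ) ≤ n := by positivity
  calc (n : ℝ) * bump4β n r ≤ (n : ℝ) * (((n : ℝ) + 1) ^ 4 / 16) := mul_le_mul_of_nonneg_left hb hn0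
    _ ≤ 4 * bump4S n := by
        unfold bump4S
        nlinarith [pow_nonneg hn0 2, pow_nonneg hn0 3, pow_nonneg hn0 4, pow_nonneg hn0 5]

/-- the two END VALUES are `O(n⁻²)`: `β̃(0) ≤ 60/n²`. [cite: Balaban1984PropagatorsI, p.25; bookkeeping] -/
theorem bump4N_zero_le {n : ℕ} (hn : 1 ≤ n) : bump4N n 0 ≤ 60 / (n : ℝ) ^ 2 := by
  unfold bump4N bump4β
  have hS := bump4S_pos hn
  have h1 : (1 : ℝ) ≤ n := by exact_mod_cast hn
  have hn0 : (0 : ℝ) < n := by positivity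
  rw [div_le_div_iff₀ hS (by positivity)]
  unfold bump4S
  push_cast
  nlinarith [pow_nonneg hn0.le 2, pow_nonneg hn0.le 3, pow_nonneg hn0.le 4, pow_nonneg hn0.le 5,
    pow_nonneg hn0.le 6]

/-- `β̃(n−1) ≤ 60/n²`. [cite: Balaban1984PropagatorsI, p.25; bookkeeping] -/
theorem bump4N_last_le {n : ℕ} (hn : 1 ≤ n) : bump4N n (n - 1) ≤ 60 / (n : ℝ) ^ 2 := by
  have hc : (((n - 1 : ℕ) : ℝ)) = (n : ℝ) - 1 := by rw [Nat.cast_sub hn, Nat.cast_one]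
  have heq : bump4N n (n - 1) = bump4N n 0 := by
    unfold bump4N bump4β; rw [hc]; ring
  rw [heq]; exact bump4N_zero_le hn

/-- the END DIFFERENCES are `O(n⁻²)` too (the profile is flat to second order at the ends): `|β̃(1) − β̃(0)| ≤ 180/n²`
(`n ≥ 2`). [cite: Balaban1984PropagatorsI, p.25; bookkeeping] -/
theorem abs_bump4N_one_sub_zero_le {n : ℕ} (hn : 2 ≤ n) : |bump4N n 1 - bump4N n 0| ≤ 180 / (n : ℝ) ^ 2 := by
  have hn1 : 1 ≤ n := le_trans (by norm_num) hn
  have hS := bump4S_pos hn1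
  have h2 : (2 : ℝ) ≤ n := by exact_mod_cast hn
  have hn0 : (0 : ℝ) < n := by positivity
  have e : bump4N n 1 - bump4N n 0 = (n : ℝ) * (3 * (n : ℝ) ^ 2 - 8 * n + 4) / bump4S n := by
    unfold bump4N bump4β; push_cast; field_simp; ring
  rw [e, abs_div, abs_of_pos hS, div_le_div_iff₀ hS (by positivity)]
  have hpos : 0 ≤ 3 * (n : ℝ) ^ 2 - 8 * n + 4 := by nlinarith
  rw [abs_of_nonneg (mul_nonneg hn0.le hpos)]
  unfold bump4S
  nlinarith [pow_nonneg hn0.le 2, pow_nonneg hn0.le 3, pow_nonneg hn0.le 4, pow_nonneg hn0.le 5,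
    pow_nonneg hn0.le 6]

/-- `|β̃(n−1) − β̃(n−2)| ≤ 180/n²` (`n ≥ 2`). [cite: Balaban1984PropagatorsI, p.25; bookkeeping] -/
theorem abs_bump4N_last_sub_le {n : ℕ} (hn : 2 ≤ n) : |bump4N n (n - 1) - bump4N n (n - 2)| ≤ 180 / (n : ℝ) ^ 2 := by
  have hn1 : 1 ≤ n := le_trans (by norm_num) hn
  have hc1 : (((n - 1 : ℕ) : ℝ)) = (n : ℝ) - 1 := by rw [Nat.cast_sub hn1, Nat.cast_one]
  have hc2 : (((n - 2 : ℕ) : ℝ)) = (n : ℝ) - 2 := by rw [Nat.cast_sub hn]; norm_num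
  have heq : bump4N n (n - 1) - bump4N n (n - 2) = -(bump4N n 1 - bump4N n 0) := by
    unfold bump4N bump4β; rw [hc1, hc2]; push_cast; ring
  rw [heq, abs_neg]; exact abs_bump4N_one_sub_zero_le hn

/-- **the SECOND DIFFERENCES are `O(n⁻²)`**: `|β̃(r+1) − 2β̃(r) + β̃(r−1)| ≤ 180/n²` for `1 ≤ r ≤ n − 2`.
[cite: Balaban1984PropagatorsI, p.25; bookkeeping] -/
theorem abs_bump4N_secondDiff_le {n r : ℕ} (hn : 1 ≤ n) (hr1 : 1 ≤ r) (hr2 : r + 2 ≤ n) :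
    |bump4N n (r + 1) - 2 * bump4N n r + bump4N n (r - 1)| ≤ 180 / (n : ℝ) ^ 2 := by
  have hS := bump4S_pos hn
  have hn0 : (0 : ℝ) < n := by exact_mod_cast (show 0 < n by omega)
  have hcr : (((r - 1 : ℕ) : ℝ)) = (r : ℝ) - 1 := by rw [Nat.cast_sub hr1, Nat.cast_one]
  have hr0 : (1 : ℝ) ≤ r := by exact_mod_cast hr1
  have hrn : (r : ℝ) + 2 ≤ n := by exact_mod_cast hr2
  -- `Δ²β(r) = 12m² − 12(n+1)m + 2(n+1)² + 2`, `m = r + 1`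
  have e : bump4N n (r + 1) - 2 * bump4N n r + bump4N n (r - 1)
      = (n : ℝ) * (12 * ((r : ℝ) + 1) ^ 2 - 12 * ((n : ℝ) + 1) * ((r : ℝ) + 1) + 2 * ((n : ℝ) + 1) ^ 2 + 2) /
        bump4S n := by
    unfold bump4N bump4β; rw [hcr]; push_cast; field_simp; ring
  rw [e, abs_div, abs_of_pos hS, div_le_div_iff₀ hS (by positivity), abs_mul, abs_of_pos hn0]
  have hD : |12 * ((r : ℝ) + 1) ^ 2 - 12 * ((n : ℝ) + 1) * ((r : ℝ) + 1) + 2 * ((n : ℝ) + 1) ^ 2 + 2|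
      ≤ 3 * ((n : ℝ) + 1) ^ 2 := by
    rw [abs_le]; constructor
    · nlinarith [sq_nonneg (2 * ((r : ℝ) + 1) - ((n : ℝ) + 1))]
    · have hm0 : 0 ≤ (r : ℝ) + 1 := by linarith
      have hmN : (r : ℝ) + 1 ≤ (n : ℝ) + 1 := by linarith
      nlinarith [mul_nonneg hm0 (sub_nonneg.2 hmN)]
  calc (n : ℝ) * |12 * ((r : ℝ) + 1) ^ 2 - 12 * ((n : ℝ) + 1) * ((r : ℝ) + 1) + 2 * ((n : ℝ) + 1) ^ 2 + 2| *
        (n : ℝ) ^ 2 ≤ (n : ℝ) * (3 * ((n : ℝ) + 1) ^ 2) * (n : ℝ) ^ 2 := by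
        apply mul_le_mul_of_nonneg_right (mul_le_mul_of_nonneg_left hD hn0.le) (by positivity)
    _ ≤ 180 * bump4S n := by
        unfold bump4S
        nlinarith [pow_nonneg hn0.le 2, pow_nonneg hn0.le 3, pow_nonneg hn0.le 4, pow_nonneg hn0.le 5]

end Profile

/-! ## §2 The second-order-flat block bump on a box family -/

section Bump

variable {ℓ Mh k R : ℕ} {P : Fin (d + 1) → ℕ} (D : Domains d ℓ Mh k P R)

/-- `x_μ mod n < n`. [folklore] -/
private theorem offN_lt' {n : ℕ} (hn : 1 ≤ n) (z : Fin (d + 1) → ℤ) (μ : Fin (d + 1)) : offN n z μ < n := by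
  unfold offN
  have h0 : (0 : ℤ) ≤ z μ % (n : ℤ) := Int.emod_nonneg _ (by exact_mod_cast (by omega : n ≠ 0))
  have h1 : z μ % (n : ℤ) < n := Int.emod_lt_of_pos _ (by exact_mod_cast hn)
  exact (Int.toNat_lt h0).2 h1

/-- `x_μ = n·⌊x_μ/n⌋ + (x_μ mod n)`. [folklore] -/
private theorem coord_eq' {n : ℕ} (hn : 1 ≤ n) (z : Fin (d + 1) → ℤ) (μ : Fin (d + 1)) :
    z μ = (n : ℤ) * blk n z μ + (offN n z μ : ℤ) := by
  unfold offN blk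
  have h0 : (0 : ℤ) ≤ z μ % (n : ℤ) := Int.emod_nonneg _ (by exact_mod_cast (by omega : n ≠ 0))
  rw [Int.toNat_of_nonneg h0]
  exact (Int.mul_ediv_add_emod _ _).symm

/-- the offset of a chart point is its chart coordinate. [folklore] -/
private theorem offN_finePt' {n : ℕ} (hn : 1 ≤ n) (y : Fin (d + 1) → ℤ) (t : Fin (d + 1) → Fin n) (μ : Fin (d + 1)) :
    offN n (B4Green244.finePt n y t) μ = t μ := by
  have h := coord_eq' hn (B4Green244.finePt n y t) μ
  rw [B4BoxCov237.blk_finePt hn, B4BoxCov237.finePt_apply] at h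
  exact_mod_cast (add_left_cancel h).symm

/-- **the block bump** `b(x) = Π_μ β̃_{L^j}(x_μ mod L^j)`, `x ∈ B^j(y)`, built from the second-order-flat profile of §1.
[cite: Balaban1984PropagatorsII, (2.74)–(2.78) p.236; Balaban1984PropagatorsI, p.25; bookkeeping] -/
def bump4 (x : ↥(boxDom (N0 ℓ Mh k P))) : ℝ :=
  ∏ μ, bump4N (nb D (blkOf D x)) (offN (nb D (blkOf D x)) x.1 μ)

/-- the product of the bump factors OFF the direction `μ`. [cite: Balaban1984PropagatorsI, p.25; bookkeeping] -/
def rest (x : ↥(boxDom (N0 ℓ Mh k P))) (μ : Fin (d + 1)) : ℝ :=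
  ∏ ν ∈ Finset.univ.erase μ, bump4N (nb D (blkOf D x)) (offN (nb D (blkOf D x)) x.1 ν)

/-- a product of `m` profile values lies in `[0, 4^m]`. [folklore] -/
private theorem prod_bump4N_le {n : ℕ} (hn : 1 ≤ n) (T : Finset (Fin (d + 1))) (r : Fin (d + 1) → ℕ)
    (hr : ∀ μ, r μ < n) : 0 ≤ ∏ μ ∈ T, bump4N n (r μ) ∧ ∏ μ ∈ T, bump4N n (r μ) ≤ (4 : ℝ) ^ T.card := by
  refine ⟨Finset.prod_nonneg fun μ _ => bump4N_nonneg n (r μ) hn, ?_⟩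
  calc ∏ μ ∈ T, bump4N n (r μ) ≤ ∏ _μ ∈ T, (4 : ℝ) :=
        Finset.prod_le_prod (fun μ _ => bump4N_nonneg n (r μ) hn) fun μ _ => bump4N_le (hr μ)
    _ = (4 : ℝ) ^ T.card := Finset.prod_const _

/-- `b ≥ 0`. [cite: Balaban1984PropagatorsI, p.25; bookkeeping] -/
theorem bump4_nonneg (x : ↥(boxDom (N0 ℓ Mh k P))) : 0 ≤ bump4 D x :=
  Finset.prod_nonneg fun _ _ => bump4N_nonneg _ _ (one_le_nb D _)

/-- `rest ≥ 0`. [cite: Balaban1984PropagatorsI, p.25; bookkeeping] -/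
theorem rest_nonneg (x : ↥(boxDom (N0 ℓ Mh k P))) (μ : Fin (d + 1)) : 0 ≤ rest D x μ :=
  Finset.prod_nonneg fun _ _ => bump4N_nonneg _ _ (one_le_nb D _)

/-- `rest ≤ 4^d`. [cite: Balaban1984PropagatorsI, p.25; bookkeeping] -/
theorem rest_le (x : ↥(boxDom (N0 ℓ Mh k P))) (μ : Fin (d + 1)) : rest D x μ ≤ (4 : ℝ) ^ d := by
  have h := (prod_bump4N_le (one_le_nb D (blkOf D x)) (Finset.univ.erase μ)
    (fun ν => offN (nb D (blkOf D x)) x.1 ν) fun ν => offN_lt' (one_le_nb D _) _ _).2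
  rwa [Finset.card_erase_of_mem (Finset.mem_univ μ), Finset.card_univ, Fintype.card_fin, Nat.add_sub_cancel] at h

/-- `b = β̃(x_μ mod n)·rest_μ`. [cite: Balaban1984PropagatorsI, p.25; bookkeeping] -/
theorem bump4_eq_mul_rest (x : ↥(boxDom (N0 ℓ Mh k P))) (μ : Fin (d + 1)) :
    bump4 D x = bump4N (nb D (blkOf D x)) (offN (nb D (blkOf D x)) x.1 μ) * rest D x μ := by
  unfold bump4 rest
  rw [← Finset.mul_prod_erase Finset.univ _ (Finset.mem_univ μ)]

/-- **the bump is `O(n⁻²)` on the faces of its block**: if `x_μ mod L^j ∈ {0, L^j − 1}` for some `μ` then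
`b(x) ≤ (60/n²)·4^d`, `n = L^j`. [cite: Balaban1984PropagatorsI, p.25; bookkeeping] -/
theorem bump4_face_le (x : ↥(boxDom (N0 ℓ Mh k P))) (μ : Fin (d + 1))
    (h : offN (nb D (blkOf D x)) x.1 μ = 0 ∨ offN (nb D (blkOf D x)) x.1 μ + 1 = nb D (blkOf D x)) :
    bump4 D x ≤ 60 / ((nb D (blkOf D x) : ℕ) : ℝ) ^ 2 * (4 : ℝ) ^ d := by
  set n := nb D (blkOf D x) with hn
  have hn1 : 1 ≤ n := one_le_nb D _
  rw [bump4_eq_mul_rest D x μ, ← hn]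
  have hsmall : bump4N n (offN n x.1 μ) ≤ 60 / (n : ℝ) ^ 2 := by
    rcases h with h | h
    · rw [h]; exact bump4N_zero_le hn1
    · have : offN n x.1 μ = n - 1 := by omega
      rw [this]; exact bump4N_last_le hn1
  exact mul_le_mul hsmall (rest_le D x μ) (rest_nonneg D x μ) (by positivity)

/-- **the block sum of the bump is `W(y)`**: `Σ_{x∈B^j(y)} b(x) = Π_μ Σ_{r<L^j} β̃(r) = (L^j)^{d+1}`.
[cite: Balaban1984PropagatorsI, p.25; bookkeeping] -/
theorem sum_bump4_fiber (s : ↥(bset D)) :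
    ∑ x ∈ Finset.univ.filter (fun x => blkOf D x = s), bump4 D x = W D s := by
  classical
  rw [sum_fiber_eq_sum_chart]
  have hterm : ∀ t : Fin (d + 1) → Fin (nb D s), bump4 D (siteOf D s t) = ∏ μ, bump4N (nb D s) (t μ) := by
    intro t
    unfold bump4
    rw [blkOf_siteOf]
    refine Finset.prod_congr rfl fun μ _ => ?_
    rw [show (siteOf D s t).1 = B4Green244.finePt (nb D s) s.1.2 t from rfl, offN_finePt' (one_le_nb D s)]
  rw [Finset.sum_congr rfl fun t _ => hterm t, ← Fintype.prod_sum fun μ (r : Fin (nb D s)) => bump4N (nb D s) r]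
  rw [Finset.prod_const, Finset.card_univ, Fintype.card_fin, Fin.sum_univ_eq_sum_range (fun r => bump4N (nb D s) r),
    sum_bump4N (one_le_nb D s), W_eq_nb_pow]

/-- offsets of lattice neighbours inside one block: equal off `μ`, shifted by one at `μ`. [cite: Balaban1984PropagatorsII, (2.1) p.224, dictionary] -/
theorem offN_add_single {x x' : ↥(boxDom (N0 ℓ Mh k P))} (hs : B6Geom246MultiLevelBoxL0.blkOf D x' = blkOf D x) {μ : Fin (d + 1)}
    (hx' : x'.1 = x.1 + Pi.single μ 1) (ν : Fin (d + 1)) :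
    (offN (nb D (blkOf D x)) x'.1 ν : ℤ) = offN (nb D (blkOf D x)) x.1 ν + (if ν = μ then 1 else 0) := by
  set n := nb D (blkOf D x) with hn
  have hn1 : 1 ≤ n := one_le_nb D _
  have hblk : blk n x'.1 = blk n x.1 := (blk_eq_iff_blkOf_eq D x x').2 hs
  have h1 := coord_eq' hn1 x.1 ν
  have h2 := coord_eq' hn1 x'.1 ν
  rw [hblk] at h2
  have hval : x'.1 ν = x.1 ν + (if ν = μ then 1 else 0) := by
    rw [hx', Pi.add_apply, Pi.single_apply]
  linarith

/-- the factors off `μ` do not see a step in the direction `μ`. [cite: Balaban1984PropagatorsI, p.25; bookkeeping] -/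
theorem rest_add_single {x x' : ↥(boxDom (N0 ℓ Mh k P))} (hs : blkOf D x' = blkOf D x) {μ : Fin (d + 1)}
    (hx' : x'.1 = x.1 + Pi.single μ 1) : rest D x' μ = rest D x μ := by
  unfold rest
  rw [hs]
  refine Finset.prod_congr rfl fun ν hν => ?_
  have h := offN_add_single D hs hx' ν
  rw [if_neg (Finset.ne_of_mem_erase hν), add_zero] at h
  have h' : offN (nb D (blkOf D x)) x'.1 ν = offN (nb D (blkOf D x)) x.1 ν := by exact_mod_cast h
  rw [h']

/-- the bump at the forward neighbour inside the block: the `μ`-factor advances by one step.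
[cite: Balaban1984PropagatorsI, p.25; bookkeeping] -/
theorem bump4_add_single {x x' : ↥(boxDom (N0 ℓ Mh k P))} (hs : blkOf D x' = blkOf D x) {μ : Fin (d + 1)}
    (hx' : x'.1 = x.1 + Pi.single μ 1) :
    bump4 D x' = bump4N (nb D (blkOf D x)) (offN (nb D (blkOf D x)) x.1 μ + 1) * rest D x μ := by
  rw [bump4_eq_mul_rest D x' μ, rest_add_single D hs hx', hs]
  have h := offN_add_single D hs hx' μ
  rw [if_pos rfl] at h
  have h' : offN (nb D (blkOf D x)) x'.1 μ = offN (nb D (blkOf D x)) x.1 μ + 1 := by exact_mod_cast h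
  rw [h']

end Bump

/-! ## §3 The test field `v = Σ_y (L^j)⁴ω(y)·b·1_{B^j(y)}`, its pairing with `Q′*ω`, its local error scale -/

section TestField

variable {ℓ Mh k R : ℕ} {P : Fin (d + 1) → ℕ} (D : Domains d ℓ Mh k P R) (ω : ↥(bset D) → ℝ)

/-- **the test field** `v(x) = (L^j)⁴·ω(y)·b(x)` for `x ∈ B^j(y)` — amplitude `(L^jη)⁴ω(y)`, the level weight of `G′²`.
[cite: Balaban1984PropagatorsII, (2.72)–(2.78) p.236; Balaban1984PropagatorsI, p.25] -/
def testV4 (x : ↥(boxDom (N0 ℓ Mh k P))) : ℝ :=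
  ((nb D (blkOf D x) : ℕ) : ℝ) ^ 4 * ω (blkOf D x) * bump4 D x

/-- **the level-weighted norm `T(ω) = Σ_y W(y)(L^j)⁴ω(y)²`** (= `Σ_j (L^jη)⁴‖ω_j‖²` in the pairing (2.69)).
[cite: Balaban1984PropagatorsII, (2.69) p.235, (2.78) p.236] -/
def T4 : ℝ := ∑ s, W D s * ((nb D s : ℕ) : ℝ) ^ 4 * ω s ^ 2

/-- **the local error scale** `E(x) = (L^j)²|ω(y)|`, `x ∈ B^j(y)`. [cite: Balaban1984PropagatorsII, (2.78) p.236; bookkeeping] -/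
def Esc (x : ↥(boxDom (N0 ℓ Mh k P))) : ℝ := ((nb D (blkOf D x) : ℕ) : ℝ) ^ 2 * |ω (blkOf D x)|

/-- `T(ω) ≥ 0`. [cite: Balaban1984PropagatorsII, (2.69) p.235, dictionary] -/
theorem T4_nonneg : 0 ≤ T4 D ω :=
  Finset.sum_nonneg fun s _ => mul_nonneg (mul_nonneg (W_pos D s).le (by positivity)) (sq_nonneg _)

/-- `E ≥ 0`. [cite: Balaban1984PropagatorsII, (2.78) p.236; bookkeeping] -/
theorem Esc_nonneg (x : ↥(boxDom (N0 ℓ Mh k P))) : 0 ≤ Esc D ω x := by unfold Esc; positivity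

/-- **`Σ_x E(x)² = T(ω)`** (each block contributes `W(y)·(L^j)⁴ω(y)²`). [cite: Balaban1984PropagatorsII, (2.69) p.235; bookkeeping] -/
theorem sum_Esc_sq : ∑ x, Esc D ω x ^ 2 = T4 D ω := by
  unfold Esc T4
  have h := sum_blockFun D fun s => ((nb D s : ℕ) : ℝ) ^ 4 * ω s ^ 2
  calc ∑ x, (((nb D (blkOf D x) : ℕ) : ℝ) ^ 2 * |ω (blkOf D x)|) ^ 2
      = ∑ x, ((nb D (blkOf D x) : ℕ) : ℝ) ^ 4 * ω (blkOf D x) ^ 2 :=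
        Finset.sum_congr rfl fun x _ => by rw [mul_pow, sq_abs]; ring
    _ = ∑ s, W D s * (((nb D s : ℕ) : ℝ) ^ 4 * ω s ^ 2) := h
    _ = _ := Finset.sum_congr rfl fun s _ => by ring

/-- the block sum of the test field: `Σ_{x∈B^j(y)} v(x) = (L^j)⁴ω(y)W(y)`. [cite: Balaban1984PropagatorsII, (2.74) p.236; bookkeeping] -/
theorem sum_testV4_fiber (s : ↥(bset D)) :
    ∑ x ∈ Finset.univ.filter (fun x => blkOf D x = s), testV4 D ω x = ((nb D s : ℕ) : ℝ) ^ 4 * ω s * W D s := by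
  unfold testV4
  rw [Finset.sum_congr rfl fun x hx => by rw [(Finset.mem_filter.1 hx).2], ← Finset.mul_sum, sum_bump4_fiber]

/-- **`⟨v, Q′*ω⟩ = T(ω)`**: the bump has block mean one. [cite: Balaban1984PropagatorsII, (2.72)–(2.74) p.236; Balaban1984PropagatorsI, p.25] -/
theorem testV4_dot_QsB : testV4 D ω ⬝ᵥ QsB D ω = T4 D ω := by
  classical
  unfold dotProduct T4
  simp only [QsB_apply]
  rw [← Finset.sum_fiberwise Finset.univ (blkOf D) (fun x => testV4 D ω x * ω (blkOf D x))]
  refine Finset.sum_congr rfl fun s _ => ?_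
  rw [Finset.sum_congr rfl fun x hx => by rw [(Finset.mem_filter.1 hx).2], ← Finset.sum_mul, sum_testV4_fiber]
  ring

/-- **the face bound**: if `x` lies on a face of its block then `|v(x)| ≤ 60·4^d·E(x)`. [cite: Balaban1984PropagatorsI, p.25; bookkeeping] -/
theorem abs_testV4_le_of_face (x : ↥(boxDom (N0 ℓ Mh k P))) (μ : Fin (d + 1))
    (h : offN (nb D (blkOf D x)) x.1 μ = 0 ∨ offN (nb D (blkOf D x)) x.1 μ + 1 = nb D (blkOf D x)) :
    |testV4 D ω x| ≤ 60 * (4 : ℝ) ^ d * Esc D ω x := by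
  have hb := bump4_face_le D x μ h
  have hb0 := bump4_nonneg D x
  set n : ℝ := ((nb D (blkOf D x) : ℕ) : ℝ) with hn
  have hn1 : (1 : ℝ) ≤ n := by rw [hn]; exact_mod_cast one_le_nb D _
  unfold testV4 Esc
  rw [← hn, abs_mul, abs_mul, abs_of_nonneg hb0, abs_of_nonneg (by positivity : (0 : ℝ) ≤ n ^ 4)]
  calc n ^ 4 * |ω (blkOf D x)| * bump4 D x ≤ n ^ 4 * |ω (blkOf D x)| * (60 / n ^ 2 * (4 : ℝ) ^ d) :=
        mul_le_mul_of_nonneg_left hb (by positivity)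
    _ = 60 * (4 : ℝ) ^ d * (n ^ 2 * |ω (blkOf D x)|) := by field_simp
    _ = _ := rfl

/-- **the interior second difference**: for `x⁻, x, x⁺` consecutive along `e_μ` in ONE block,
`|2v(x) − v(x⁺) − v(x⁻)| ≤ 180·4^d·E(x)`. [cite: Balaban1984PropagatorsI, p.25; bookkeeping] -/
theorem abs_testV4_secondDiff_le {xm x xp : ↥(boxDom (N0 ℓ Mh k P))} (hsp : blkOf D xp = blkOf D x)
    (hsm : blkOf D xm = blkOf D x) {μ : Fin (d + 1)} (hxp : xp.1 = x.1 + Pi.single μ 1)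
    (hx : x.1 = xm.1 + Pi.single μ 1) :
    |2 * testV4 D ω x - testV4 D ω xp - testV4 D ω xm| ≤ 180 * (4 : ℝ) ^ d * Esc D ω x := by
  set n := nb D (blkOf D x) with hn
  have hn1 : 1 ≤ n := one_le_nb D _
  set r := offN n x.1 μ with hr
  -- offsets: `r − 1, r, r + 1`, all `< n`
  have hoffm := offN_add_single D hsm.symm hx μ
  rw [if_pos rfl, hsm] at hoffm
  have hr1 : 1 ≤ r := by
    have : (0 : ℤ) ≤ offN n xm.1 μ := by positivity
    have : (1 : ℤ) ≤ (offN (nb D (blkOf D x)) x.1 μ : ℤ) := by rw [hoffm]; linarith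
    rw [hr, hn]; exact_mod_cast this
  have hrm : offN n xm.1 μ = r - 1 := by
    have : (offN (nb D (blkOf D x)) x.1 μ : ℤ) = offN (nb D (blkOf D x)) xm.1 μ + 1 := hoffm
    rw [hr, hn]; omega
  have hr2 : r + 2 ≤ n := by
    have h := offN_add_single D hsp hxp μ
    rw [if_pos rfl] at h
    have hlt := offN_lt' hn1 xp.1 μ
    have : (offN n xp.1 μ : ℤ) = r + 1 := by rw [hr, hn]; exact h
    omega
  -- the three values
  have hvp : testV4 D ω xp = (n : ℝ) ^ 4 * ω (blkOf D x) * (bump4N n (r + 1) * rest D x μ) := by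
    unfold testV4; rw [bump4_add_single D hsp hxp, hsp]
  have hv : testV4 D ω x = (n : ℝ) ^ 4 * ω (blkOf D x) * (bump4N n r * rest D x μ) := by
    unfold testV4; rw [bump4_eq_mul_rest D x μ]
  have hvm : testV4 D ω xm = (n : ℝ) ^ 4 * ω (blkOf D x) * (bump4N n (r - 1) * rest D x μ) := by
    unfold testV4
    rw [bump4_eq_mul_rest D xm μ, ← rest_add_single D hsm.symm hx, hsm, ← hn, hrm]
  rw [hvp, hv, hvm]
  have hΔ := abs_bump4N_secondDiff_le hn1 hr1 hr2
  have hR0 := rest_nonneg D x μ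
  have hR := rest_le D x μ
  have hn0 : (0 : ℝ) < n := by exact_mod_cast hn1
  unfold Esc; rw [← hn]
  have e : 2 * ((n : ℝ) ^ 4 * ω (blkOf D x) * (bump4N n r * rest D x μ))
      - (n : ℝ) ^ 4 * ω (blkOf D x) * (bump4N n (r + 1) * rest D x μ)
      - (n : ℝ) ^ 4 * ω (blkOf D x) * (bump4N n (r - 1) * rest D x μ)
      = -((n : ℝ) ^ 4 * ω (blkOf D x) * rest D x μ * (bump4N n (r + 1) - 2 * bump4N n r + bump4N n (r - 1))) := by
    ring
  rw [e, abs_neg, abs_mul, abs_mul, abs_mul, abs_of_nonneg hR0, abs_of_nonneg (by positivity : (0 : ℝ) ≤ (n:ℝ) ^ 4)]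
  calc (n : ℝ) ^ 4 * |ω (blkOf D x)| * rest D x μ * |bump4N n (r + 1) - 2 * bump4N n r + bump4N n (r - 1)|
      ≤ (n : ℝ) ^ 4 * |ω (blkOf D x)| * (4 : ℝ) ^ d * (180 / (n : ℝ) ^ 2) := by
        apply mul_le_mul (mul_le_mul_of_nonneg_left hR (by positivity)) hΔ (abs_nonneg _) (by positivity)
    _ = 180 * (4 : ℝ) ^ d * ((n : ℝ) ^ 2 * |ω (blkOf D x)|) := by field_simp
    _ = _ := by ring

/-- **the one-sided difference at the TOP face**: `x = x⁻ + e_μ` in one block with `x_μ mod n = n − 1`: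
`|v(x) − v(x⁻)| ≤ 180·4^d·E(x)`. [cite: Balaban1984PropagatorsI, p.25; bookkeeping] -/
theorem abs_testV4_sub_le_of_top {xm x : ↥(boxDom (N0 ℓ Mh k P))} (hsm : blkOf D xm = blkOf D x) {μ : Fin (d + 1)}
    (hx : x.1 = xm.1 + Pi.single μ 1) (htop : offN (nb D (blkOf D x)) x.1 μ + 1 = nb D (blkOf D x)) :
    |testV4 D ω x - testV4 D ω xm| ≤ 180 * (4 : ℝ) ^ d * Esc D ω x := by
  set n := nb D (blkOf D x) with hn
  have hn1 : 1 ≤ n := one_le_nb D _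
  have hoffm := offN_add_single D hsm.symm hx μ
  rw [if_pos rfl, hsm] at hoffm
  have hn2 : 2 ≤ n := by
    have : (0 : ℤ) ≤ offN n xm.1 μ := by positivity
    have h1 : (1 : ℤ) ≤ (offN (nb D (blkOf D x)) x.1 μ : ℤ) := by rw [hoffm]; linarith
    have h1' : 1 ≤ offN n x.1 μ := by rw [hn]; exact_mod_cast h1
    omega
  have hxr : offN n x.1 μ = n - 1 := by omega
  have hrm : offN n xm.1 μ = n - 2 := by
    have : (offN (nb D (blkOf D x)) x.1 μ : ℤ) = offN (nb D (blkOf D x)) xm.1 μ + 1 := hoffm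
    rw [← hn, hxr] at this
    omega
  have hv : testV4 D ω x = (n : ℝ) ^ 4 * ω (blkOf D x) * (bump4N n (n - 1) * rest D x μ) := by
    unfold testV4; rw [bump4_eq_mul_rest D x μ, ← hn, hxr]
  have hvm : testV4 D ω xm = (n : ℝ) ^ 4 * ω (blkOf D x) * (bump4N n (n - 2) * rest D x μ) := by
    unfold testV4
    rw [bump4_eq_mul_rest D xm μ, ← rest_add_single D hsm.symm hx, hsm, ← hn, hrm]
  rw [hv, hvm]
  have hΔ := abs_bump4N_last_sub_le hn2
  have hR0 := rest_nonneg D x μ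
  have hR := rest_le D x μ
  have hn0 : (0 : ℝ) < n := by exact_mod_cast hn1
  unfold Esc; rw [← hn]
  have e : (n : ℝ) ^ 4 * ω (blkOf D x) * (bump4N n (n - 1) * rest D x μ)
      - (n : ℝ) ^ 4 * ω (blkOf D x) * (bump4N n (n - 2) * rest D x μ)
      = (n : ℝ) ^ 4 * ω (blkOf D x) * rest D x μ * (bump4N n (n - 1) - bump4N n (n - 2)) := by ring
  rw [e, abs_mul, abs_mul, abs_mul, abs_of_nonneg hR0, abs_of_nonneg (by positivity : (0 : ℝ) ≤ (n:ℝ) ^ 4)]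
  calc (n : ℝ) ^ 4 * |ω (blkOf D x)| * rest D x μ * |bump4N n (n - 1) - bump4N n (n - 2)|
      ≤ (n : ℝ) ^ 4 * |ω (blkOf D x)| * (4 : ℝ) ^ d * (180 / (n : ℝ) ^ 2) := by
        apply mul_le_mul (mul_le_mul_of_nonneg_left hR (by positivity)) hΔ (abs_nonneg _) (by positivity)
    _ = 180 * (4 : ℝ) ^ d * ((n : ℝ) ^ 2 * |ω (blkOf D x)|) := by field_simp
    _ = _ := by ring

/-- **the one-sided difference at the BOTTOM face**: `x⁺ = x + e_μ` in one block with `x_μ mod n = 0`: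
`|v(x) − v(x⁺)| ≤ 180·4^d·E(x)`. [cite: Balaban1984PropagatorsI, p.25; bookkeeping] -/
theorem abs_testV4_sub_le_of_bot {x xp : ↥(boxDom (N0 ℓ Mh k P))} (hsp : blkOf D xp = blkOf D x) {μ : Fin (d + 1)}
    (hxp : xp.1 = x.1 + Pi.single μ 1) (hbot : offN (nb D (blkOf D x)) x.1 μ = 0) :
    |testV4 D ω x - testV4 D ω xp| ≤ 180 * (4 : ℝ) ^ d * Esc D ω x := by
  set n := nb D (blkOf D x) with hn
  have hn1 : 1 ≤ n := one_le_nb D _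
  have hn2 : 2 ≤ n := by
    have h := offN_add_single D hsp hxp μ
    rw [if_pos rfl, ← hn, hbot] at h
    have hlt := offN_lt' hn1 xp.1 μ
    have : (offN n xp.1 μ : ℤ) = 1 := by push_cast at h; linarith
    omega
  have hv : testV4 D ω x = (n : ℝ) ^ 4 * ω (blkOf D x) * (bump4N n 0 * rest D x μ) := by
    unfold testV4; rw [bump4_eq_mul_rest D x μ, ← hn, hbot]
  have hvp : testV4 D ω xp = (n : ℝ) ^ 4 * ω (blkOf D x) * (bump4N n 1 * rest D x μ) := by
    unfold testV4; rw [bump4_add_single D hsp hxp, hsp, ← hn, hbot]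
  rw [hv, hvp]
  have hΔ := abs_bump4N_one_sub_zero_le hn2
  have hR0 := rest_nonneg D x μ
  have hR := rest_le D x μ
  have hn0 : (0 : ℝ) < n := by exact_mod_cast hn1
  unfold Esc; rw [← hn]
  have e : (n : ℝ) ^ 4 * ω (blkOf D x) * (bump4N n 0 * rest D x μ)
      - (n : ℝ) ^ 4 * ω (blkOf D x) * (bump4N n 1 * rest D x μ)
      = -((n : ℝ) ^ 4 * ω (blkOf D x) * rest D x μ * (bump4N n 1 - bump4N n 0)) := by ring
  rw [e, abs_neg, abs_mul, abs_mul, abs_mul, abs_of_nonneg hR0, abs_of_nonneg (by positivity : (0 : ℝ) ≤ (n:ℝ) ^ 4)]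
  calc (n : ℝ) ^ 4 * |ω (blkOf D x)| * rest D x μ * |bump4N n 1 - bump4N n 0|
      ≤ (n : ℝ) ^ 4 * |ω (blkOf D x)| * (4 : ℝ) ^ d * (180 / (n : ℝ) ^ 2) := by
        apply mul_le_mul (mul_le_mul_of_nonneg_left hR (by positivity)) hΔ (abs_nonneg _) (by positivity)
    _ = 180 * (4 : ℝ) ^ d * ((n : ℝ) ^ 2 * |ω (blkOf D x)|) := by field_simp
    _ = _ := by ring

end TestField

/-! ## §4 Torus neighbours and blocks: a bond leaves a block only through a face -/

section Torus

variable {ℓ Mh k R : ℕ} {P : Fin (d + 1) → ℕ} (D : TDomains d ℓ Mh k P R)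

/-- `(n·b + t)/n = b` for `0 ≤ t < n`. [folklore] -/
private theorem ediv_helper {n : ℤ} (hn : 0 < n) (b : ℤ) {t : ℤ} (ht0 : 0 ≤ t) (htn : t < n) :
    (n * b + t) / n = b := by
  rw [Int.mul_add_ediv_left _ _ hn.ne', Int.ediv_eq_zero_of_lt ht0 htn, add_zero]

/-- the label of the block of `x` in the grid of its own size. [cite: Balaban1984PropagatorsII, (2.1) p.224, dictionary] -/
theorem blk_nb_eq (x : ↥(boxDom (N0 ℓ Mh k P))) :
    blk (B6QGQCoerciveMultiLevelBoxL0.nb D.toDomains (blkOf D.toDomains x)) x.1 = (blkOf D.toDomains x).1.2 := rfl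

/-- **a block is a proper part of the torus in every direction**: `L^j < N₀_μ` (`L ≥ 2`, `j ≤ k`).
[cite: Balaban1984PropagatorsII, (2.1) p.224, dictionary] -/
theorem nb_lt_N0 (hℓ : 1 ≤ ℓ) (hMh : 1 ≤ Mh) (hP : ∀ μ, 1 ≤ P μ) (s : ↥(B6Geom246MultiLevelBoxL0.bset D.toDomains)) (μ : Fin (d + 1)) :
    (nb D.toDomains s : ℤ) < (N0 ℓ Mh k P μ : ℤ) := by
  have hjk : s.1.1 ≤ k := (scale_bounds D.toDomains s).2
  have h1 : nb D.toDomains s ≤ (ℓ + 1) ^ k := Nat.pow_le_pow_right (by omega) hjk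
  have h2 : (ℓ + 1) ^ k < (ℓ + 1) ^ (k + 1) := Nat.pow_lt_pow_right (by omega) (by omega)
  have h3 : (ℓ + 1) ^ (k + 1) ≤ N0 ℓ Mh k P μ := by
    rw [N0_eq_bigSide_mul]; unfold bigSide
    have := hP μ
    calc (ℓ + 1) ^ (k + 1) = 1 * (ℓ + 1) ^ (k + 1) * 1 := by ring
      _ ≤ Mh * (ℓ + 1) ^ (k + 1) * P μ := by gcongr
  exact_mod_cast lt_of_le_of_lt h1 (lt_of_lt_of_le h2 h3)

/-- **THE FORWARD TORUS NEIGHBOUR OFF THE TOP FACE** is the lattice neighbour `x + e_μ` and lies in the same block.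
[cite: Balaban1984PropagatorsII, (2.1) p.224; Balaban1983RegularityDecay, p.572 (periodic conditions), dictionary] -/
theorem fwd_of_lt (x : ↥(boxDom (N0 ℓ Mh k P))) (μ : Fin (d + 1))
    (h : offN (B6QGQCoerciveMultiLevelBoxL0.nb D.toDomains (blkOf D.toDomains x)) x.1 μ + 1 < nb D.toDomains (blkOf D.toDomains x)) :
    (tshift (N0 ℓ Mh k P) (unitVec μ) x).1 = x.1 + Pi.single μ 1 ∧
      blkOf D.toDomains (tshift (N0 ℓ Mh k P) (unitVec μ) x) = blkOf D.toDomains x := by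
  set s := blkOf D.toDomains x with hs
  set n := nb D.toDomains s with hn
  have hn1 : 1 ≤ n := one_le_nb _ _
  have hnz : (0 : ℤ) < n := by exact_mod_cast hn1
  have hc := coord_eq' hn1 x.1 μ
  have hb : blk n x.1 μ = s.1.2 μ := by rw [hn, hs, blk_nb_eq]
  have hfit := block_fits D.toDomains s μ
  rw [← hn] at hfit
  rw [hb] at hc
  have hmem : x.1 + Pi.single μ 1 ∈ boxDom (N0 ℓ Mh k P) := mem_boxDom.2 fun i => by
    have hx := (mem_boxDom.1 x.2) i
    by_cases hi : i = μ
    · subst hi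
      rw [Pi.add_apply, Pi.single_eq_same]
      have : ((offN n x.1 i : ℕ) : ℤ) + 1 < n := by exact_mod_cast h
      constructor <;> omega
    · rw [Pi.add_apply, Pi.single_eq_of_ne hi, add_zero]; exact hx
  have hval : (tshift (N0 ℓ Mh k P) (unitVec μ) x).1 = x.1 + Pi.single μ 1 := tshift_val_of_mem hmem
  refine ⟨hval, ?_⟩
  rw [← blk_eq_iff_blkOf_eq D.toDomains x, ← hs, ← hn, hval]
  funext ν
  dsimp only [blk]
  by_cases hν : ν = μ
  · subst hν
    rw [Pi.add_apply, Pi.single_eq_same, hc, add_assoc, ediv_helper hnz _ (by positivity) (by exact_mod_cast h),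
      ediv_helper hnz _ (by positivity) (by exact_mod_cast offN_lt' hn1 x.1 ν)]
  · rw [Pi.add_apply, Pi.single_eq_of_ne hν, add_zero]

/-- **THE BACKWARD TORUS NEIGHBOUR OFF THE BOTTOM FACE** is the lattice neighbour `x − e_μ` and lies in the same block.
[cite: Balaban1984PropagatorsII, (2.1) p.224; Balaban1983RegularityDecay, p.572 (periodic conditions), dictionary] -/
theorem bwd_of_pos (x : ↥(boxDom (N0 ℓ Mh k P))) (μ : Fin (d + 1))
    (h : 1 ≤ offN (B6QGQCoerciveMultiLevelBoxL0.nb D.toDomains (blkOf D.toDomains x)) x.1 μ) :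
    (tshift (N0 ℓ Mh k P) (-unitVec μ) x).1 = x.1 - Pi.single μ 1 ∧
      blkOf D.toDomains (tshift (N0 ℓ Mh k P) (-unitVec μ) x) = blkOf D.toDomains x := by
  set s := blkOf D.toDomains x with hs
  set n := nb D.toDomains s with hn
  have hn1 : 1 ≤ n := one_le_nb _ _
  have hnz : (0 : ℤ) < n := by exact_mod_cast hn1
  have hc := coord_eq' hn1 x.1 μ
  have hb : blk n x.1 μ = s.1.2 μ := by rw [hn, hs, blk_nb_eq]
  have hfit := block_fits D.toDomains s μ
  rw [← hn] at hfit
  have hlt := offN_lt' hn1 x.1 μ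
  rw [hb] at hc
  have hmem : x.1 + -Pi.single μ 1 ∈ boxDom (N0 ℓ Mh k P) := mem_boxDom.2 fun i => by
    have hx := (mem_boxDom.1 x.2) i
    by_cases hi : i = μ
    · subst hi
      rw [Pi.add_apply, Pi.neg_apply, Pi.single_eq_same]
      have : (1 : ℤ) ≤ ((offN n x.1 i : ℕ) : ℤ) := by exact_mod_cast h
      constructor <;> omega
    · rw [Pi.add_apply, Pi.neg_apply, Pi.single_eq_of_ne hi, neg_zero, add_zero]; exact hx
  have hval : (tshift (N0 ℓ Mh k P) (-unitVec μ) x).1 = x.1 - Pi.single μ 1 := by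
    rw [sub_eq_add_neg]; exact tshift_val_of_mem hmem
  refine ⟨hval, ?_⟩
  rw [← blk_eq_iff_blkOf_eq D.toDomains x, ← hs, ← hn, hval]
  funext ν
  dsimp only [blk]
  by_cases hν : ν = μ
  · subst hν
    rw [Pi.sub_apply, Pi.single_eq_same, hc, add_sub_assoc,
      ediv_helper hnz _ (by have : (1 : ℤ) ≤ ((offN n x.1 ν : ℕ) : ℤ) := (by exact_mod_cast h); omega)
        (by have : ((offN n x.1 ν : ℕ) : ℤ) < n := (by exact_mod_cast hlt); omega),
      ediv_helper hnz _ (by positivity) (by exact_mod_cast hlt)]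
  · rw [Pi.sub_apply, Pi.single_eq_of_ne hν, sub_zero]

/-- contrapositive: a forward torus bond LEAVES the block of `x` only through the top face `x_μ mod L^j = L^j − 1`.
[cite: Balaban1984PropagatorsII, (2.1) p.224, dictionary] -/
theorem top_of_blkOf_fwd_ne {x : ↥(boxDom (N0 ℓ Mh k P))} {μ : Fin (d + 1)}
    (hne : B6Geom246MultiLevelBoxL0.blkOf D.toDomains (tshift (N0 ℓ Mh k P) (unitVec μ) x) ≠ blkOf D.toDomains x) :
    offN (nb D.toDomains (blkOf D.toDomains x)) x.1 μ + 1 = nb D.toDomains (blkOf D.toDomains x) := by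
  have hlt := offN_lt' (one_le_nb D.toDomains (blkOf D.toDomains x)) x.1 μ
  by_contra h
  exact hne (fwd_of_lt D x μ (by omega)).2

/-- contrapositive: a backward torus bond LEAVES the block of `x` only through the bottom face `x_μ mod L^j = 0`.
[cite: Balaban1984PropagatorsII, (2.1) p.224, dictionary] -/
theorem bot_of_blkOf_bwd_ne {x : ↥(boxDom (N0 ℓ Mh k P))} {μ : Fin (d + 1)}
    (hne : B6Geom246MultiLevelBoxL0.blkOf D.toDomains (tshift (N0 ℓ Mh k P) (-unitVec μ) x) ≠ blkOf D.toDomains x) :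
    offN (nb D.toDomains (blkOf D.toDomains x)) x.1 μ = 0 := by
  by_contra h
  exact hne (bwd_of_pos D x μ (by omega)).2

/-- **the forward torus bond from a TOP-face site leaves the block** (a block never wraps around the torus: `L^j < N₀`).
[cite: Balaban1984PropagatorsII, (2.1) p.224; Balaban1983RegularityDecay, p.572, dictionary] -/
theorem blkOf_fwd_ne_of_top (hℓ : 1 ≤ ℓ) (hMh : 1 ≤ Mh) (hP : ∀ μ, 1 ≤ P μ) {x : ↥(boxDom (N0 ℓ Mh k P))}
    {μ : Fin (d + 1)} (htop : offN (B6QGQCoerciveMultiLevelBoxL0.nb D.toDomains (blkOf D.toDomains x)) x.1 μ + 1 = nb D.toDomains (blkOf D.toDomains x)) :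
    blkOf D.toDomains (tshift (N0 ℓ Mh k P) (unitVec μ) x) ≠ blkOf D.toDomains x := by
  set s := blkOf D.toDomains x with hs
  set n := nb D.toDomains s with hn
  set z := tshift (N0 ℓ Mh k P) (unitVec μ) x with hz
  intro heq
  have hn1 : 1 ≤ n := one_le_nb _ _
  have hN := nb_lt_N0 D hℓ hMh hP s μ
  -- coordinates of `x` and `z` in the direction `μ`
  have hcx := coord_eq' hn1 x.1 μ
  rw [show blk n x.1 μ = s.1.2 μ by rw [hn, hs, blk_nb_eq]] at hcx
  have hcz := coord_eq' hn1 z.1 μ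
  have hbz : blk n z.1 = s.1.2 := by rw [hn, ← heq]; exact blk_nb_eq D z
  rw [show blk n z.1 μ = s.1.2 μ from congrFun hbz μ] at hcz
  have hltz := offN_lt' hn1 z.1 μ
  -- `z_μ ≡ x_μ + 1 (mod N₀_μ)`
  have hzval : z.1 μ = (x.1 μ + 1) % (N0 ℓ Mh k P μ : ℤ) := by
    rw [hz, tshift_val]
    show (x.1 + unitVec μ) μ % (N0 ℓ Mh k P μ : ℤ) = _
    rw [Pi.add_apply]; unfold unitVec; rw [Pi.single_eq_same]
  have hdiv := Int.mul_ediv_add_emod (x.1 μ + 1) (N0 ℓ Mh k P μ : ℤ)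
  rw [← hzval] at hdiv
  -- `z_μ − x_μ = 1 − N₀t` with `z_μ − x_μ ∈ [−(n−1), 0]`: impossible since `N₀ > n`
  set t := (x.1 μ + 1) / (N0 ℓ Mh k P μ : ℤ) with ht
  have htop' : ((offN n x.1 μ : ℕ) : ℤ) + 1 = n := by exact_mod_cast htop
  have hz0 : (0 : ℤ) ≤ offN n z.1 μ := by positivity
  have hzn : ((offN n z.1 μ : ℕ) : ℤ) < n := by exact_mod_cast hltz
  rcases le_or_gt t 0 with ht0 | ht0
  · have : (N0 ℓ Mh k P μ : ℤ) * t ≤ 0 := mul_nonpos_of_nonneg_of_nonpos (by positivity) ht0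
    nlinarith
  · have : (N0 ℓ Mh k P μ : ℤ) * 1 ≤ (N0 ℓ Mh k P μ : ℤ) * t := mul_le_mul_of_nonneg_left ht0 (by positivity)
    nlinarith

/-- **the backward torus bond from a BOTTOM-face site leaves the block**. [cite: Balaban1984PropagatorsII, (2.1) p.224; Balaban1983RegularityDecay, p.572, dictionary] -/
theorem blkOf_bwd_ne_of_bot (hℓ : 1 ≤ ℓ) (hMh : 1 ≤ Mh) (hP : ∀ μ, 1 ≤ P μ) {x : ↥(boxDom (N0 ℓ Mh k P))}
    {μ : Fin (d + 1)} (hbot : offN (B6QGQCoerciveMultiLevelBoxL0.nb D.toDomains (blkOf D.toDomains x)) x.1 μ = 0) :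
    blkOf D.toDomains (tshift (N0 ℓ Mh k P) (-unitVec μ) x) ≠ blkOf D.toDomains x := by
  set s := blkOf D.toDomains x with hs
  set n := nb D.toDomains s with hn
  set z := tshift (N0 ℓ Mh k P) (-unitVec μ) x with hz
  intro heq
  have hn1 : 1 ≤ n := one_le_nb _ _
  have hN := nb_lt_N0 D hℓ hMh hP s μ
  have hcx := coord_eq' hn1 x.1 μ
  rw [show blk n x.1 μ = s.1.2 μ by rw [hn, hs, blk_nb_eq]] at hcx
  have hcz := coord_eq' hn1 z.1 μ
  have hbz : blk n z.1 = s.1.2 := by rw [hn, ← heq]; exact blk_nb_eq D z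
  rw [show blk n z.1 μ = s.1.2 μ from congrFun hbz μ] at hcz
  have hltz := offN_lt' hn1 z.1 μ
  have hzval : z.1 μ = (x.1 μ - 1) % (N0 ℓ Mh k P μ : ℤ) := by
    rw [hz, tshift_val]
    show (x.1 + -unitVec μ) μ % (N0 ℓ Mh k P μ : ℤ) = _
    rw [Pi.add_apply, Pi.neg_apply]; unfold unitVec; rw [Pi.single_eq_same]; rfl
  have hdiv := Int.mul_ediv_add_emod (x.1 μ - 1) (N0 ℓ Mh k P μ : ℤ)
  rw [← hzval] at hdiv
  set t := (x.1 μ - 1) / (N0 ℓ Mh k P μ : ℤ) with ht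
  have hbot' : ((offN n x.1 μ : ℕ) : ℤ) = 0 := by exact_mod_cast hbot
  have hz0 : (0 : ℤ) ≤ offN n z.1 μ := by positivity
  have hzn : ((offN n z.1 μ : ℕ) : ℤ) < n := by exact_mod_cast hltz
  rcases le_or_gt 0 t with ht0 | ht0
  · have : (0 : ℤ) ≤ (N0 ℓ Mh k P μ : ℤ) * t := mul_nonneg (by positivity) ht0
    nlinarith
  · have : (N0 ℓ Mh k P μ : ℤ) * t ≤ (N0 ℓ Mh k P μ : ℤ) * (-1) :=
      mul_le_mul_of_nonneg_left (by omega) (by positivity)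
    nlinarith

variable (ω : ↥(bset D.toDomains) → ℝ)

/-- a site whose backward torus neighbour lies in another block is a BOTTOM-face site: `|v| ≤ 60·4^d·E` there.
[cite: Balaban1984PropagatorsI, p.25; bookkeeping] -/
theorem abs_testV4_le_of_bwd_ne {z : ↥(boxDom (N0 ℓ Mh k P))} {μ : Fin (d + 1)}
    (hne : blkOf D.toDomains (tshift (N0 ℓ Mh k P) (-unitVec μ) z) ≠ blkOf D.toDomains z) :
    |testV4 D.toDomains ω z| ≤ 60 * (4 : ℝ) ^ d * Esc D.toDomains ω z :=
  abs_testV4_le_of_face D.toDomains ω z μ (Or.inl (bot_of_blkOf_bwd_ne D hne))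

/-- a site whose forward torus neighbour lies in another block is a TOP-face site: `|v| ≤ 60·4^d·E` there.
[cite: Balaban1984PropagatorsI, p.25; bookkeeping] -/
theorem abs_testV4_le_of_fwd_ne {z : ↥(boxDom (N0 ℓ Mh k P))} {μ : Fin (d + 1)}
    (hne : blkOf D.toDomains (tshift (N0 ℓ Mh k P) (unitVec μ) z) ≠ blkOf D.toDomains z) :
    |testV4 D.toDomains ω z| ≤ 60 * (4 : ℝ) ^ d * Esc D.toDomains ω z :=
  abs_testV4_le_of_face D.toDomains ω z μ (Or.inr (top_of_blkOf_fwd_ne D hne))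

/-- **THE BOND-PAIR BOUND**: for every site `x` and direction `μ`,
`|2v(x) − v(σ_{e_μ}x) − v(σ_{−e_μ}x)| ≤ 240·4^d·E(x) + 60·4^d·(E(σ_{e_μ}x) + E(σ_{−e_μ}x))` — inside the block the second
difference of the bump is `O(n⁻²)`; at a face the inner one-sided difference and the value are `O(n⁻²)` and the outer
neighbour is itself a face site of ITS block. [cite: Balaban1984PropagatorsII, (2.74)–(2.78) p.236; Balaban1984PropagatorsI, p.25; bookkeeping] -/
theorem abs_pair_le (hℓ : 1 ≤ ℓ) (hMh : 1 ≤ Mh) (hP : ∀ μ, 1 ≤ P μ) (x : ↥(boxDom (N0 ℓ Mh k P))) (μ : Fin (d + 1)) :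
    |2 * testV4 D.toDomains ω x - testV4 D.toDomains ω (tshift (N0 ℓ Mh k P) (unitVec μ) x)
        - testV4 D.toDomains ω (tshift (N0 ℓ Mh k P) (-unitVec μ) x)|
      ≤ 240 * (4 : ℝ) ^ d * Esc D.toDomains ω x
        + 60 * (4 : ℝ) ^ d * (Esc D.toDomains ω (tshift (N0 ℓ Mh k P) (unitVec μ) x)
          + Esc D.toDomains ω (tshift (N0 ℓ Mh k P) (-unitVec μ) x)) := by
  set s := blkOf D.toDomains x with hs
  set n := nb D.toDomains s with hn
  set xp := tshift (N0 ℓ Mh k P) (unitVec μ) x with hxp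
  set xm := tshift (N0 ℓ Mh k P) (-unitVec μ) x with hxm
  set r := offN n x.1 μ with hr
  have hn1' : 1 ≤ n := by rw [hn]; exact one_le_nb _ _
  have hrlt : r < n := offN_lt' (by omega) x.1 μ
  have hE := Esc_nonneg D.toDomains ω x
  have hEp := Esc_nonneg D.toDomains ω xp
  have hEm := Esc_nonneg D.toDomains ω xm
  have h4 : (0 : ℝ) ≤ (4 : ℝ) ^ d := by positivity
  by_cases hn1 : n = 1
  · -- LEVEL-0 TWIN: a level-`0` block is a single site (`n = L⁰ = 1`), at once a bottom and a top face of its block;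
    -- both torus neighbours lie in OTHER blocks and are face sites of theirs
    have hr0 : r = 0 := by omega
    have h2 := abs_testV4_le_of_face D.toDomains ω x μ (Or.inl (by rw [← hs, ← hn, ← hr, hr0]))
    have hnem : blkOf D.toDomains xm ≠ blkOf D.toDomains x :=
      blkOf_bwd_ne_of_bot D hℓ hMh hP (by rw [← hs, ← hn, ← hr, hr0])
    have hnep : blkOf D.toDomains xp ≠ blkOf D.toDomains x :=
      blkOf_fwd_ne_of_top D hℓ hMh hP (by rw [← hs, ← hn, ← hr]; omega)
    have hnem' : blkOf D.toDomains (tshift (N0 ℓ Mh k P) (unitVec μ) xm) ≠ blkOf D.toDomains xm := by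
      rw [hxm, fwd_bwd]; exact hnem.symm
    have hnep' : blkOf D.toDomains (tshift (N0 ℓ Mh k P) (-unitVec μ) xp) ≠ blkOf D.toDomains xp := by
      rw [hxp, bwd_fwd]; exact hnep.symm
    have h3m := abs_testV4_le_of_fwd_ne D ω hnem'
    have h3p := abs_testV4_le_of_bwd_ne D ω hnep'
    have e : 2 * testV4 D.toDomains ω x - testV4 D.toDomains ω xp - testV4 D.toDomains ω xm
        = (testV4 D.toDomains ω x - testV4 D.toDomains ω xp) + (testV4 D.toDomains ω x - testV4 D.toDomains ω xm) := by ring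
    rw [e]
    calc |(testV4 D.toDomains ω x - testV4 D.toDomains ω xp) + (testV4 D.toDomains ω x - testV4 D.toDomains ω xm)|
        ≤ |testV4 D.toDomains ω x - testV4 D.toDomains ω xp| + |testV4 D.toDomains ω x - testV4 D.toDomains ω xm| :=
          abs_add_le _ _
      _ ≤ (|testV4 D.toDomains ω x| + |testV4 D.toDomains ω xp|) + (|testV4 D.toDomains ω x| + |testV4 D.toDomains ω xm|) :=
          add_le_add (abs_sub _ _) (abs_sub _ _)
      _ ≤ _ := by nlinarith [h2, h3p, h3m, hE, hEp, hEm, h4]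
  have hn2 : 2 ≤ n := by omega
  by_cases hr0 : r = 0
  · -- bottom face: `x⁺` inside, `x⁻` outside and a top-face site of its block
    obtain ⟨hvp, hsp⟩ := fwd_of_lt D x μ (by rw [← hs, ← hn, ← hr, hr0]; omega)
    have h1 := abs_testV4_sub_le_of_bot D.toDomains ω hsp hvp (by rw [← hs, ← hn, ← hr, hr0])
    have h2 := abs_testV4_le_of_face D.toDomains ω x μ (Or.inl (by rw [← hs, ← hn, ← hr, hr0]))
    have hne : blkOf D.toDomains xm ≠ blkOf D.toDomains x :=
      blkOf_bwd_ne_of_bot D hℓ hMh hP (by rw [← hs, ← hn, ← hr, hr0])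
    have hne' : blkOf D.toDomains (tshift (N0 ℓ Mh k P) (unitVec μ) xm) ≠ blkOf D.toDomains xm := by
      rw [hxm, fwd_bwd]; exact hne.symm
    have h3 := abs_testV4_le_of_fwd_ne D ω hne'
    calc |2 * testV4 D.toDomains ω x - testV4 D.toDomains ω xp - testV4 D.toDomains ω xm|
        = |(testV4 D.toDomains ω x - testV4 D.toDomains ω xp) + testV4 D.toDomains ω x
            + -testV4 D.toDomains ω xm| := by ring_nf
      _ ≤ |testV4 D.toDomains ω x - testV4 D.toDomains ω xp| + |testV4 D.toDomains ω x|
            + |-testV4 D.toDomains ω xm| := abs_add_three _ _ _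
      _ ≤ 180 * (4 : ℝ) ^ d * Esc D.toDomains ω x + 60 * (4 : ℝ) ^ d * Esc D.toDomains ω x
            + 60 * (4 : ℝ) ^ d * Esc D.toDomains ω xm := by rw [abs_neg]; exact add_le_add (add_le_add h1 h2) h3
      _ ≤ _ := by nlinarith
  by_cases hrt : r + 1 = n
  · -- top face: `x⁻` inside, `x⁺` outside and a bottom-face site of its block
    obtain ⟨hvm, hsm⟩ := bwd_of_pos D x μ (by rw [← hs, ← hn, ← hr]; omega)
    have hx : x.1 = xm.1 + Pi.single μ 1 := by rw [hvm, sub_add_cancel]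
    have h1 := abs_testV4_sub_le_of_top D.toDomains ω hsm hx (by rw [← hs, ← hn, ← hr, hrt])
    have h2 := abs_testV4_le_of_face D.toDomains ω x μ (Or.inr (by rw [← hs, ← hn, ← hr, hrt]))
    have hne : blkOf D.toDomains xp ≠ blkOf D.toDomains x :=
      blkOf_fwd_ne_of_top D hℓ hMh hP (by rw [← hs, ← hn, ← hr, hrt])
    have hne' : blkOf D.toDomains (tshift (N0 ℓ Mh k P) (-unitVec μ) xp) ≠ blkOf D.toDomains xp := by
      rw [hxp, bwd_fwd]; exact hne.symm
    have h3 := abs_testV4_le_of_bwd_ne D ω hne'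
    calc |2 * testV4 D.toDomains ω x - testV4 D.toDomains ω xp - testV4 D.toDomains ω xm|
        = |(testV4 D.toDomains ω x - testV4 D.toDomains ω xm) + testV4 D.toDomains ω x
            + -testV4 D.toDomains ω xp| := by ring_nf
      _ ≤ |testV4 D.toDomains ω x - testV4 D.toDomains ω xm| + |testV4 D.toDomains ω x|
            + |-testV4 D.toDomains ω xp| := abs_add_three _ _ _
      _ ≤ 180 * (4 : ℝ) ^ d * Esc D.toDomains ω x + 60 * (4 : ℝ) ^ d * Esc D.toDomains ω x
            + 60 * (4 : ℝ) ^ d * Esc D.toDomains ω xp := by rw [abs_neg]; exact add_le_add (add_le_add h1 h2) h3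
      _ ≤ _ := by nlinarith
  · -- interior in the direction `μ`: both neighbours inside, second difference
    obtain ⟨hvp, hsp⟩ := fwd_of_lt D x μ (by rw [← hs, ← hn, ← hr]; omega)
    obtain ⟨hvm, hsm⟩ := bwd_of_pos D x μ (by rw [← hs, ← hn, ← hr]; omega)
    have hx : x.1 = xm.1 + Pi.single μ 1 := by rw [hvm, sub_add_cancel]
    have h1 := abs_testV4_secondDiff_le D.toDomains ω hsp hsm hvp hx
    calc |2 * testV4 D.toDomains ω x - testV4 D.toDomains ω xp - testV4 D.toDomains ω xm|
        ≤ 180 * (4 : ℝ) ^ d * Esc D.toDomains ω x := h1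
      _ ≤ _ := by nlinarith

end Torus

/-! ## §5 `‖Δ′_av‖² ≤ C·T(ω)` and the GLOBAL level-weighted coercivity of `Q′G′²Q′*` on the torus -/

section Coercive

variable {ℓ Mh k R : ℕ} {P : Fin (d + 1) → ℕ} (D : TDomains d ℓ Mh k P R)

/-- **THE ROW FORMULA OF `Δ′_a` ON THE TORUS**: `(Δ′_av)(x) = (−Δ^{per}v)(x) + levC_{j(x)}·Σ_{x′∈B(y(x))}v(x′)`.
[cite: Balaban1984PropagatorsII, (2.13)–(2.14) p.225] -/
theorem mlOpT_mulVec_apply (a : ℕ → ℝ) (v : ↥(boxDom (N0 ℓ Mh k P)) → ℝ) (x : ↥(boxDom (N0 ℓ Mh k P))) :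
    (mlOpT (N0 ℓ Mh k P) ℓ k D.lev a *ᵥ v) x = (perLapT (N0 ℓ Mh k P) *ᵥ v) x
      + levC d ℓ a (D.lev x.1) * ∑ x' ∈ Finset.univ.filter (fun x' => B6Geom246MultiLevelBoxL0.blkOf D.toDomains x' = blkOf D.toDomains x), v x' := by
  classical
  change ∑ x', mlOpT (N0 ℓ Mh k P) ℓ k D.lev a x x' * v x' = (∑ x', perLapT (N0 ℓ Mh k P) x x' * v x') + _
  simp only [mlOpT_apply D rfl a, add_mul, Finset.sum_add_distrib]
  congr 1
  have hb : ∀ x' : ↥(boxDom (N0 ℓ Mh k P)), B4Reflection242.avgK (levC d ℓ a (D.lev x.1)) ((ℓ + 1) ^ D.lev x.1) x.1 x'.1 * v x'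
      = if blkOf D.toDomains x' = blkOf D.toDomains x then levC d ℓ a (D.lev x.1) * v x' else 0 := by
    intro x'
    have hiff : blk ((ℓ + 1) ^ D.lev x.1) x'.1 = blk ((ℓ + 1) ^ D.lev x.1) x.1 ↔ blkOf D.toDomains x' = blkOf D.toDomains x :=
      blk_eq_iff_blkOf_eq D.toDomains x x'
    unfold B4Reflection242.avgK
    by_cases h : blkOf D.toDomains x' = blkOf D.toDomains x
    · rw [if_pos (hiff.2 h), if_pos h]
    · rw [if_neg (fun hh => h (hiff.1 hh)), if_neg h, zero_mul]
  rw [Finset.sum_congr rfl fun x' _ => hb x', ← Finset.sum_filter, Finset.mul_sum]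

variable (ω : ↥(bset D.toDomains) → ℝ)

/-- **THE POINTWISE BOUND ON `Δ′_av`**: `|(Δ′_av)(x)| ≤ c₁E(x) + c₂Σ_μ(E(σ_{e_μ}x) + E(σ_{−e_μ}x))` for weights
`0 < a_j ≤ a₊` (`j ≥ 0`, LEVEL-0 TWIN; the averaging term is `a_j(L^j)²ω(y)` exactly). [cite: Balaban1984PropagatorsII, (2.74)–(2.78) p.236; Balaban1984PropagatorsI, p.25] -/
theorem abs_mlOpT_testV4_le (hℓ : 1 ≤ ℓ) (hMh : 1 ≤ Mh) (hP : ∀ μ, 1 ≤ P μ) {a : ℕ → ℝ} {aplus : ℝ}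
    (ha : ∀ j, 0 < a j) (hale : ∀ j, a j ≤ aplus) (x : ↥(boxDom (N0 ℓ Mh k P))) :
    |(mlOpT (N0 ℓ Mh k P) ℓ k D.lev a *ᵥ testV4 D.toDomains ω) x|
      ≤ c1T d aplus * Esc D.toDomains ω x + c2T d * ∑ μ, (Esc D.toDomains ω (tshift (N0 ℓ Mh k P) (unitVec μ) x)
          + Esc D.toDomains ω (tshift (N0 ℓ Mh k P) (-unitVec μ) x)) := by
  rw [mlOpT_mulVec_apply, sum_testV4_fiber, perLapT_mulVec]
  -- the averaging term is `a_j·(L^j)²·ω(y)`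
  set s := blkOf D.toDomains x with hs
  have hlev : D.lev x.1 = s.1.1 := rfl
  have hn0 : (0 : ℝ) < ((nb D.toDomains s : ℕ) : ℝ) := by exact_mod_cast one_le_nb _ _
  have havg : levC d ℓ a (D.lev x.1) * (((nb D.toDomains s : ℕ) : ℝ) ^ 4 * ω s * W D.toDomains s)
      = a s.1.1 * (((nb D.toDomains s : ℕ) : ℝ) ^ 2 * ω s) := by
    rw [hlev]; unfold levC
    have hL : (((ℓ : ℝ) + 1) ^ s.1.1) = ((nb D.toDomains s : ℕ) : ℝ) := by unfold nb; push_cast; ring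
    rw [hL, W_eq_nb_pow]
    field_simp
  rw [havg]
  have haj := ha s.1.1
  have hajle := hale s.1.1
  have hA : |a s.1.1 * (((nb D.toDomains s : ℕ) : ℝ) ^ 2 * ω s)| ≤ aplus * Esc D.toDomains ω x := by
    unfold Esc; rw [← hs, abs_mul, abs_of_pos haj, abs_mul, abs_of_nonneg (by positivity)]
    exact mul_le_mul_of_nonneg_right hajle (by positivity)
  have hpairs := fun μ => abs_pair_le D ω hℓ hMh hP x μ
  have hsum : |∑ μ, (2 * testV4 D.toDomains ω x - testV4 D.toDomains ω (tshift (N0 ℓ Mh k P) (unitVec μ) x)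
        - testV4 D.toDomains ω (tshift (N0 ℓ Mh k P) (-unitVec μ) x))|
      ≤ ∑ μ : Fin (d + 1), (240 * (4 : ℝ) ^ d * Esc D.toDomains ω x
        + 60 * (4 : ℝ) ^ d * (Esc D.toDomains ω (tshift (N0 ℓ Mh k P) (unitVec μ) x)
          + Esc D.toDomains ω (tshift (N0 ℓ Mh k P) (-unitVec μ) x))) :=
    (Finset.abs_sum_le_sum_abs _ _).trans (Finset.sum_le_sum fun μ _ => hpairs μ)
  rw [Finset.sum_add_distrib, Finset.sum_const, Finset.card_univ, Fintype.card_fin, nsmul_eq_mul,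
    ← Finset.mul_sum] at hsum
  refine (abs_add_le _ _).trans ?_
  unfold c1T c2T
  push_cast at hsum ⊢
  nlinarith [hsum, hA, Esc_nonneg D.toDomains ω x]

/-- **`‖Δ′_av‖² ≤ C₄·T(ω)`**: the square of the pointwise bound, summed with `Σ_xE(σx)² = Σ_xE(x)² = T(ω)`.
[cite: Balaban1984PropagatorsII, (2.78) p.236; Balaban1984PropagatorsI, p.25] -/
theorem normSq_mlOpT_testV4_le (hℓ : 1 ≤ ℓ) (hMh : 1 ≤ Mh) (hP : ∀ μ, 1 ≤ P μ) {a : ℕ → ℝ} {aplus : ℝ}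
    (ha : ∀ j, 0 < a j) (hale : ∀ j, a j ≤ aplus) :
    ∑ x, ((mlOpT (N0 ℓ Mh k P) ℓ k D.lev a *ᵥ testV4 D.toDomains ω) x) ^ 2 ≤ C4 d aplus * T4 D.toDomains ω := by
  -- opaque local names (no `set`): `E`, the neighbour maps, the row vector `w`
  obtain ⟨E, hE⟩ : ∃ E : ↥(boxDom (N0 ℓ Mh k P)) → ℝ, E = Esc D.toDomains ω := ⟨_, rfl⟩
  obtain ⟨σp, hσp⟩ : ∃ σp : Fin (d + 1) → ↥(boxDom (N0 ℓ Mh k P)) ≃ ↥(boxDom (N0 ℓ Mh k P)),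
      σp = fun μ => tshift (N0 ℓ Mh k P) (unitVec μ) := ⟨_, rfl⟩
  obtain ⟨σm, hσm⟩ : ∃ σm : Fin (d + 1) → ↥(boxDom (N0 ℓ Mh k P)) ≃ ↥(boxDom (N0 ℓ Mh k P)),
      σm = fun μ => tshift (N0 ℓ Mh k P) (-unitVec μ) := ⟨_, rfl⟩
  obtain ⟨w, hw⟩ : ∃ w : ↥(boxDom (N0 ℓ Mh k P)) → ℝ, w = mlOpT (N0 ℓ Mh k P) ℓ k D.lev a *ᵥ testV4 D.toDomains ω :=
    ⟨_, rfl⟩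
  have hE0 : ∀ x, 0 ≤ E x := fun x => by rw [hE]; exact Esc_nonneg _ _ _
  have hsumE : ∑ x, E x ^ 2 = T4 D.toDomains ω := by rw [hE]; exact sum_Esc_sq _ _
  have hc2 : 0 ≤ c2T d := by unfold c2T; positivity
  -- pointwise: `w(x)² ≤ 2c₁²E(x)² + 4c₂²(d+1)Σ_μ(E(σ⁺x)² + E(σ⁻x)²)`
  have hpt : ∀ x, w x ^ 2 ≤ 2 * c1T d aplus ^ 2 * E x ^ 2
        + 4 * c2T d ^ 2 * ((d : ℝ) + 1) * ∑ μ, (E (σp μ x) ^ 2 + E (σm μ x) ^ 2) := by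
    intro x
    have h := abs_mlOpT_testV4_le D ω hℓ hMh hP ha hale x
    rw [← hE, ← hw] at h
    obtain ⟨S, hS⟩ : ∃ S : ℝ, S = ∑ μ, (E (σp μ x) + E (σm μ x)) := ⟨_, rfl⟩
    have hSeq : ∑ μ, (E (tshift (N0 ℓ Mh k P) (unitVec μ) x) + E (tshift (N0 ℓ Mh k P) (-unitVec μ) x)) = S := by
      rw [hS, hσp, hσm]
    rw [hSeq] at h
    have h1 : w x ^ 2 ≤ (c1T d aplus * E x + c2T d * S) ^ 2 := by
      rw [← sq_abs]; exact pow_le_pow_left₀ (abs_nonneg _) h 2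
    -- `S² ≤ (d+1)·Σ(E⁺ + E⁻)² ≤ 2(d+1)Σ(E⁺² + E⁻²)`
    have hCS : S ^ 2 ≤ ((d : ℝ) + 1) * ∑ μ, (E (σp μ x) + E (σm μ x)) ^ 2 := by
      have h := sq_sum_le_card_mul_sum_sq (s := (Finset.univ : Finset (Fin (d + 1))))
        (f := fun μ => E (σp μ x) + E (σm μ x))
      rw [Finset.card_univ, Fintype.card_fin, ← hS] at h
      push_cast at h
      exact h
    have hsq : ∑ μ, (E (σp μ x) + E (σm μ x)) ^ 2 ≤ 2 * ∑ μ, (E (σp μ x) ^ 2 + E (σm μ x) ^ 2) := by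
      rw [Finset.mul_sum]
      exact Finset.sum_le_sum fun μ _ => by nlinarith [sq_nonneg (E (σp μ x) - E (σm μ x))]
    have hsum0 : 0 ≤ ∑ μ, (E (σp μ x) ^ 2 + E (σm μ x) ^ 2) :=
      Finset.sum_nonneg fun μ _ => add_nonneg (sq_nonneg _) (sq_nonneg _)
    have hS2 : S ^ 2 ≤ ((d : ℝ) + 1) * (2 * ∑ μ, (E (σp μ x) ^ 2 + E (σm μ x) ^ 2)) :=
      hCS.trans (mul_le_mul_of_nonneg_left hsq (by positivity))
    calc w x ^ 2 ≤ (c1T d aplus * E x + c2T d * S) ^ 2 := h1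
      _ ≤ 2 * (c1T d aplus * E x) ^ 2 + 2 * (c2T d * S) ^ 2 := by
          nlinarith [sq_nonneg (c1T d aplus * E x - c2T d * S)]
      _ = 2 * c1T d aplus ^ 2 * E x ^ 2 + 2 * c2T d ^ 2 * S ^ 2 := by ring
      _ ≤ 2 * c1T d aplus ^ 2 * E x ^ 2
          + 2 * c2T d ^ 2 * (((d : ℝ) + 1) * (2 * ∑ μ, (E (σp μ x) ^ 2 + E (σm μ x) ^ 2))) := by
          have := mul_le_mul_of_nonneg_left hS2 (by positivity : (0 : ℝ) ≤ 2 * c2T d ^ 2)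
          linarith
      _ = _ := by ring
  -- sum over `x`: translation invariance of the counting measure
  have hshift : ∀ μ, ∑ x, E (σp μ x) ^ 2 = T4 D.toDomains ω ∧ ∑ x, E (σm μ x) ^ 2 = T4 D.toDomains ω := by
    intro μ
    rw [← hsumE, hσp, hσm]
    exact ⟨Equiv.sum_comp (tshift (N0 ℓ Mh k P) (unitVec μ)) (fun x => E x ^ 2),
      Equiv.sum_comp (tshift (N0 ℓ Mh k P) (-unitVec μ)) (fun x => E x ^ 2)⟩
  have htot : ∑ x, ∑ μ, (E (σp μ x) ^ 2 + E (σm μ x) ^ 2) = 2 * ((d : ℝ) + 1) * T4 D.toDomains ω := by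
    rw [Finset.sum_comm]
    have : ∀ μ : Fin (d + 1), ∑ x, (E (σp μ x) ^ 2 + E (σm μ x) ^ 2) = 2 * T4 D.toDomains ω := by
      intro μ
      rw [Finset.sum_add_distrib, (hshift μ).1, (hshift μ).2]; ring
    rw [Finset.sum_congr rfl fun μ _ => this μ, Finset.sum_const, Finset.card_univ, Fintype.card_fin, nsmul_eq_mul]
    push_cast; ring
  rw [← hw]
  calc ∑ x, w x ^ 2
      ≤ ∑ x, (2 * c1T d aplus ^ 2 * E x ^ 2
          + 4 * c2T d ^ 2 * ((d : ℝ) + 1) * ∑ μ, (E (σp μ x) ^ 2 + E (σm μ x) ^ 2)) := Finset.sum_le_sum fun x _ => hpt x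
    _ = 2 * c1T d aplus ^ 2 * ∑ x, E x ^ 2
          + 4 * c2T d ^ 2 * ((d : ℝ) + 1) * ∑ x, ∑ μ, (E (σp μ x) ^ 2 + E (σm μ x) ^ 2) := by
        rw [Finset.sum_add_distrib, ← Finset.mul_sum, ← Finset.mul_sum]
    _ = C4 d aplus * T4 D.toDomains ω := by
        rw [htot, hsumE]; unfold C4; ring

/-- **[B6] (2.78) FOR THE GENUINE `k`-LEVEL OPERATOR ON THE TORUS, LEVEL-WEIGHTED AND GLOBAL**: for every nested
family on `T_η`, all weights `0 < a_j ≤ a₊` (`j ≥ 0`: LEVEL-0 TWIN, the level-`0` weight is genuine) and EVERY `ω` on `𝔅`,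
`⟨ω, Q′G′²Q′*ω⟩ = ‖G′Q′*ω‖² ≥ C₄⁻¹·Σ_y W(y)(L^j)⁴ω(y)²` — print's «⟨ω, (Q′G′²Q′*)ω⟩ ≥ γ₀²‖ω‖²» on the `ξ = L^{−j}`
lattice, in `η`-units, WITHOUT the restriction of `ω` to a two-level window, uniformly in `k`, `M_h`, `R`, `P` and the
family.  Route (ours, replacing the Fourier representation (2.75)–(2.76)): `‖G′u‖·‖Δ′_av‖ ≥ ⟨G′u, Δ′_av⟩ = ⟨u, v⟩` with
`u = Q′*ω`, `v` the second-order-flat test field (`⟨u, v⟩ = T(ω)`, `‖Δ′_av‖² ≤ C₄T(ω)`).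
[cite: Balaban1984PropagatorsII, (2.78) p.236, (2.72) p.236; Balaban1984PropagatorsI, p.25 (positivity of Q′G′Q′*)] -/
theorem qggq_coercive_multiLevelTorus (hℓ : 1 ≤ ℓ) (hMh : 1 ≤ Mh) (hP : ∀ μ, 1 ≤ P μ) {a : ℕ → ℝ} {aplus : ℝ}
    (ha : ∀ j, 0 < a j) (hale : ∀ j, a j ≤ aplus) :
    (C4 d aplus)⁻¹ * ∑ s, W D.toDomains s * ((nb D.toDomains s : ℕ) : ℝ) ^ 4 * ω s ^ 2
      ≤ (gmlT (N0 ℓ Mh k P) ℓ k D.lev a *ᵥ QsB D.toDomains ω) ⬝ᵥ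
          (gmlT (N0 ℓ Mh k P) ℓ k D.lev a *ᵥ QsB D.toDomains ω) := by
  set M := mlOpT (N0 ℓ Mh k P) ℓ k D.lev a with hM
  set u := QsB D.toDomains ω with hu
  set v := testV4 D.toDomains ω with hv
  set g := gmlT (N0 ℓ Mh k P) ℓ k D.lev a *ᵥ u with hg
  set w := M *ᵥ v with hw
  have hN := B6MultiLevelTorusOperator.one_le_N0 (ℓ := ℓ) (k := k) hMh hP
  have hC := C4_pos d aplus
  -- `T = ⟨v, u⟩ = ⟨g, Δ′_av⟩`
  have hT : v ⬝ᵥ u = T4 D.toDomains ω := testV4_dot_QsB D.toDomains ω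
  have hMG : M * gmlT (N0 ℓ Mh k P) ℓ k D.lev a = 1 :=
    mul_eq_one_comm.1 (B6MultiLevelTorusOperator.gmlT_mul_mlOpT hN D.lev_le ha)
  have hid : M *ᵥ g = u := by rw [hg, Matrix.mulVec_mulVec, hMG, Matrix.one_mulVec]
  have hadj : g ⬝ᵥ w = T4 D.toDomains ω := by
    rw [hw, Matrix.dotProduct_mulVec, ← Matrix.mulVec_transpose, (mlOpT_isSymm ℓ k D.lev a).eq, hid, ← hT,
      dotProduct_comm]
  -- Cauchy–Schwarz and `‖Δ′_av‖² ≤ C₄T`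
  have hcs : (g ⬝ᵥ w) ^ 2 ≤ (∑ x, g x ^ 2) * ∑ x, w x ^ 2 := Finset.sum_mul_sq_le_sq_mul_sq _ _ _
  have hww : ∑ x, w x ^ 2 ≤ C4 d aplus * T4 D.toDomains ω := normSq_mlOpT_testV4_le D ω hℓ hMh hP ha hale
  have hgg : ∑ x, g x ^ 2 = g ⬝ᵥ g := by unfold dotProduct; exact Finset.sum_congr rfl fun x _ => sq (g x)
  have hT0 := T4_nonneg D.toDomains ω
  have hg0 : 0 ≤ g ⬝ᵥ g := by rw [← hgg]; exact Finset.sum_nonneg fun x _ => sq_nonneg _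
  rw [hadj, hgg] at hcs
  change (C4 d aplus)⁻¹ * T4 D.toDomains ω ≤ g ⬝ᵥ g
  rw [inv_mul_le_iff₀ hC]
  by_cases hz : T4 D.toDomains ω = 0
  · rw [hz]; positivity
  · have hTpos : 0 < T4 D.toDomains ω := lt_of_le_of_ne hT0 (Ne.symm hz)
    have h2 : T4 D.toDomains ω ^ 2 ≤ g ⬝ᵥ g * (C4 d aplus * T4 D.toDomains ω) :=
      hcs.trans (mul_le_mul_of_nonneg_left hww hg0)
    nlinarith

end Coercive

end

end Literature.MathematicalPhysics.QuantumFieldTheory.Balaban1983to89.B6QGGQCoerciveMultiLevelTorusL0
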